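import Literature.MathematicalPhysics.QuantumFieldTheory.Balaban1983to89.B6Ineq2148TwoScaleV1
import Literature.MathematicalPhysics.QuantumFieldTheory.Balaban1983to89.B6Eq235TwoScaleV1
import Literature.MathematicalPhysics.QuantumFieldTheory.Balaban1983to89.B6Prop25DecayTwoScaleV1
import Literature.MathematicalPhysics.QuantumFieldTheory.Balaban1983to89.B6Prop25HolderRateFreeV1
import Literature.MathematicalPhysics.QuantumFieldTheory.Balaban1983to89.B6BlockDecayLapHjV1

/-!
# `Balaban1983to89.B6Cor28TwoScaleV1` — T. Bałaban, *Propagators and renormalization transformations for lattice gauge theories. II*,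
# Commun. Math. Phys. **96** (1984) 223–250 [Balaban1984PropagatorsII], p. 249 **COROLLARY 2.8** (2.150)–(2.151) FOR THE GENUINE TWO-SCALE
# `H = GQ*(QGQ*)⁻¹` OF THE DATA `tsV1` (`G = Δ_a⁻¹` of (2.90), `Q = Q″Q_j`, `Λ′ ⊂ T^{(j+1)}` ARBITRARY): `QH = I` and the three members of (2.151) —
# the decay of `|H(b, c)|`, of `|(∇H)(b, c)|` and the Hölder continuity `‖(ζ∇H)(·, c)‖_α` — uniformly in the volume, in `j`, in `Λ′` and in the weights
# of [4]'s window (ONE rate `δ₅` for all three members and all `α`), from Prop. 2.5 (gen 14–16 / p38 / r03) and (2.148) (`…B6Ineq2148TwoScaleV1`) by the block calculus, with no volume factor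

statement-level skeleton of published theorems with citation tags; proofs where landed; nothing here is a claim about the Yang–Mills mass gap

PDF held: `paper:balaban1984-cmp96-propagators-rt-ii` (journal page = PDF page + 222; p. 249 [PDF 27] read AS AN IMAGE on the ×2 render
`run/shared/lean/pub/pub-balaban/b2b-balaban-ref1/pages/1984-cmp96-propagators-rt-II/…-p027-x2.png`, 2026-08-22).

PRINT (verbatim, p. 249).  *"We will apply the results obtained until now to many different problems. At first let us consider the operator H.
We have* **Corollary 2.8.** *A kernel of the operator H, (HB)(b) = Σ_{c∈𝔅} (L^{j(c)}η)^d H(b, c)B(c), (2.150) satisfies the inequality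
|H(b, c)|, |(∇H)(b, c)|, ‖(ζ∇H)(·, c)‖_α ≦ O(1)[1, (L^jη)^{−1}, (L^jη)^{−1−α}(‖ζ‖^ξ_α + |ζ|)](L^{j′}η)^{−d}e^{−δ₅d(y,c₋)}, (1.151) [sic]
b ∈ Δ(y) or supp ζ ⊂ Δ(y), y ∈ Λ_j, c₋ ∈ Λ_{j′}. This Corollary and Proposition 2.6 are our main technical results. They will be used systematically
in subsequent papers."*  `H` is the operator of (2.35) p. 229, `H = GQ*(QGQ*)⁻¹` (the minimizer map of `⟨A, Δ_aA⟩` on `{QA = B}`), for the `G` of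
(2.90)/Prop. 2.5 and the averaging `Q` of Sect. C.

CITATION HEADER (lean-in-tree rule) — WHAT IS REPRODUCED.  Phase-2 file of the `lit-balaban` typed skeleton (HOME `run/shared/lean/pub/lit-balaban/`),
seat **p22 gen 17** (B6 fold owner r03, referee ref-4; lane = Sect. C on the concrete two-scale data `tsV1`).  SKELETON row **B6.Cor2.8** (head
`proved p254241`: p01's ONE-SCALE torus instance of the verbatim `…B6.Cor28Printed`; r03's `cor28Printed_block` on the cube geometry of Prop. 2.6;
the abstract composition `…B6Cor28.*`).  THIS FILE = the MODEL INSTANCE OF THE THREE MEMBERS OF (2.151) FOR THE GENUINE TWO-SCALE `H` OF `tsV1`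
(two adjacent levels, `Λ′ ≠ ∅` allowed, no displayed hypothesis), in the V1 vocabulary of the Prop. 2.5 lineage (block bounds over the unit torus
`T^{(j)}`, printed shapes with radius-`r` supports).  IMPORTS BY NAME, nothing restated: gen 16's `…B6Prop25DecayTwoScaleV1.blockBound_G_scaling`
((1.110)₀ for `G`), `…B6Prop25GradDecayTwoScaleV1.blockBound_DG_scaling` (the `∇G` member), r03's `…B6Prop25HolderRateFreeV1.holderBound_DG_rateFree`
((1.111) pair bound of `∇G`, `α`-free rate; the twin of p38's `…B6Prop25HolderTwoScaleV1.holderBound_DG_scaling`) and p38's pair calculus `…B6BlockHolderCalculus.holderBound_comp`/`pairDiff_le_of_support`/`abs_cutoff_pairDiff_le`, gen 16's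
`…B6BlockDecayLapHjV1.blockBound_Qv_adjoint` (`Q_j*`), gen 12's `…B6QppKernelV1.qpp_single_nonneg`/`sum_qpp_single_col` and
`…B6Kernel2147DecayV1.dist_pos_le_of_qpp_ne_zero` (the kernel of `Q″`), gen 8's `…B6Eq2143TwoScaleV1.QGQs`, gen 17's `…B6Eq235TwoScaleV1.Hts`/`adjoint_Q_eq` (the operator `H`, `Q* = Q_j*Q″*`) and
`…B6Ineq2148TwoScaleV1.ineq2148_V1_uniform` ((2.148)), gen 14's block calculus `…B6BlockDecayCalculus.blockBound_comp`/`blockBound_of_entry`/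
`abs_apply_le_of_support`/`torusDist_isPseudoDist`/`torusDist_sumBound`.

THIS FILE (indices `c ∈ 𝔅 = Λ^c ⊔ Λ′` SITED on the unit torus `T^{(j)}` by `site(o) = o₋` for a `Λ^c`-bond `o`, `site(c) = x̂(c₋)` (the anchor of
the block `B(c₋)`) for a `Λ′`-bond `c`, as in gen 12 / gen 17; fine bonds `b₀` sited by their block `y(b₀₋)`; `ρ = |· − ·|_T` the sup-distance of
`T^{(j)}`; `n = L^j`, `c = L^j` the paper's scaling, weights `a₀n^{d+1} ≤ w ≤ a₁n^{d+1}` = [4]'s window `a₀ ≤ a ≤ a₁`):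
* §1 the index set: `card_fibre_site_le` (at most `2(d+1)` indices per site), `qpp_single_le_one`, `Qpp_adjoint_entry_le` (`|Q″*(e_c)_b| = q_c(b) ≤
  e^{δ(2L−1)}e^{−δ|x_b − site(c)|_T}` for EVERY `δ ≥ 0`: `Q″` is local), **`blockBound_Qpp_adjoint`**, `blockBound_of_index_entry`;
* §2 **`blockBound_Q_adjoint`**: `Q*` has the block bound `(η^{d+1}e^{δ+1}·2(d+1)e^{δ(2L−1)}·K_{d+1}(1), δ)` for every `δ ≥ 0`;
* §3 **`blockBound_QsRinv_scaling`**: `Q*(QGQ*)⁻¹` has a block bound `(C, δ₄)` uniformly — (2.148)'s entries `O(1)κe^{−δ₄ρ}` (`κ = n^{d+1}` at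
  `c = L^j`) against the `η^{d+1} = n^{−(d+1)}` of `Q_j*`: NO net power of `n`, no volume factor;
* §4 **`blockBound_Hts_scaling`** (`Σ_{c : site(c) = y}|H(e_c)_{b₀}| ≤ Ce^{−δ₅|y(b₀₋) − y|_T}`, `δ₅ = min(δ₂/2, δ₄)`) and the printed shape
  **`cor28_ineq2151_H`**: `|(HB)(b₀)| ≤ C·e^{(1+2δ₅)r}·e^{−δ₅|y − y′|_T}·X` for `B` supported on the indices sited within `r` of `y′`, `|B| ≤ X`, `b₀` over
  the sites within `r` of `y`;
* §5 **`blockBound_DHts_scaling`**, **`cor28_ineq2151_DH`**: the same for `D_λH = n(S_λ − 1)H` (`|n((HB)(b₀ + e_λ) − (HB)(b₀))| ≤ …`);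
* §6 **`holderBound_DHts_scaling`** (pair bound `(C_α t^α, δ₅)` of `D_λH`, the rate `δ₅` `α`-FREE at fine bonds `⟨x,ν⟩, ⟨x′,ν⟩`, `|x − x′|_∞ ≤ n`, `t = |x − x′|_∞/n`) and
  **`cor28_ineq2151_holder`**: `|ζ(x)·n((HB)(b₁+e_λ) − (HB)(b₁)) − ζ(x′)·n((HB)(b₂+e_λ) − (HB)(b₂))| ≤ C_α e^{(1+2δ₅)(r+1)}e^{−δ₅|y−y′|_T}
  (Z_h + Z₀)·X·t^α` for cut-offs `ζ` over the sites within `r` of `y` with `|ζ| ≤ Z₀`, `|ζ(x) − ζ(x′)| ≤ Z_h t^α`.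
THEOREMS ONLY (the operator `Hts = G ∘ Q* ∘ (QGQ*)⁻¹`, `QH = I` and its identification with p21's `hOp` of record live in gen 17's
`…B6Eq235TwoScaleV1`); no definition, no local notation (the period vector `Mk ⟨d+1, L, m, K⟩ j` of `T^{(j)}` and the site map of `𝔅` —
`o ↦ o₋` on `Λ^c`-bonds, `c ↦ x̂(c₋)` (block anchor) on `Λ′`-bonds — are spelled out in full at each use), no `def … : Prop` fact; standard axioms.

HONEST SCOPE / DIVERGENCES. (1) TWO adjacent levels (`j(c) ∈ {j, j+1}`), the concrete V1 model (`L` odd, centred blocks, torus `T^{(j)}` of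
periods `L^{m+K−j}`); print: `k + 1` levels `{Λ_j}`. (2) Units: our `ℓ²(𝔅)` is unweighted, so our entries `H(e_c)_{b₀}` ARE print's
`(L^{j(c)}η)^dH(b₀, c)` — the factor `(L^{j′}η)^{−d}` of (2.151) is the normalisation (2.150), absorbed; our `D_λ = n(S_λ − 1)` is the difference
quotient of the `ξ = L^{−j}`-lattice, print's `∇` that of the `η`-lattice — the factor `(L^jη)^{−1}` ((2.151)₂) resp. `(L^jη)^{−1−α}` ((2.151)₃) is that
conversion; at two levels `L^jη ∈ {1, L}` up to the unit, so all length factors are constants depending on `d, L`. (3) `b ∈ Δ(y)`, `supp ζ ⊂ Δ(y)`,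
`c₋ ∈ Λ_{j′}` are replaced by the radius-`r` packaging of the Prop. 2.5 lineage (supports over the unit sites within `r` of `y`, `y′`; growth
`e^{(1+2δ)r}`; `r = 1` contains the cubes `Δ̃`), and `d(y, c₋)` by the torus sup-distance `|y − site(c)|_T` (the block anchor is within `L` of every
point of `B(c₋)`). (4) CONSTANTS: `δ₅, C` depend on `d, L` AND the weight ratios `a₀, a₁` (print: `O(1)` uniform; the tree's `G` carries [4]'s window),
`C_α` also on `α` — the RATE `δ₅` is `α`-free as printed (r03's `…B6Prop25HolderRateFreeV1`); pairs of equal direction at distance `≤ n`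
(= (1.109)'s `|x − x′| ≤ 1`). (5) The bounds are stated for `Hts` on `L²(𝔅)`; by `…B6Eq235TwoScaleV1.hOp_eq`/`hOp_single_apply` they ARE bounds for p21's `hOp (GE) (QsE) (EE)`
of record on the two-level family at the printed weights (reindexing `𝔅 ≃ BondIdx`); the verbatim `…B6.Cor28Printed` packaging on a two-scale
`Geometry` is not done here (planned).  NOT summit progress.
Unit `lit-balaban-p22` (gen 17), 2026-08-22.
-/

noncomputable section

open scoped InnerProductSpace
open Finset Matrix

namespace Literature.MathematicalPhysics.QuantumFieldTheory.Balaban1983to89.B6Cor28TwoScaleV1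

open LatticeFieldCalculus B6SectAOperatorsV1 B6SectCTwoScaleV1 B6SectCTwoScaleV1Lattice B5Eq118OneStroke
open B6SectCOperators (TwoScaleData)
open B5SectBStatements (eta)
open B4Sect5Proof (latticeConst latticeConst_nonneg)
open B4Sect5Torus (IsPseudoDist SumBound)
open B4TorusKernel.MultiPeriod (torusSupNorm torusSupNorm_nonneg)
open B5Eq117TorusCarriers (Mk)
open B6LowerBound2153Torus (rep)
open BalabanImbrieJaffe1984to88.BIJ85AxialPropagator411 (BondSpace)
open B6BlockDecayCalculus (blockBound_comp blockBound_of_entry blockBound_mono abs_apply_le_of_support adjoint_entry torusDist_isPseudoDist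
  torusDist_sumBound)
open B6BlockHolderCalculus (holderBound_comp holderBound_mono pairDiff_le_of_support abs_cutoff_pairDiff_le)
open B6Prop25HolderRateFreeV1 (holderBound_DG_rateFree)
open B6BlockDecayHprimeCovV1 (supDist_cast_eq_torusSupNorm)
open BalabanImbrieJaffe1984to88.BIJ85Ineq722Torus (supDist_blk_le_one)
open B6BlockDecayLapHjV1 (blockBound_Qv_adjoint)
open B6Prop25DecayTwoScaleV1 (blockBound_G_scaling)
open B6Prop25GradDecayTwoScaleV1 (blockBound_DG_scaling)
open B6BlockDecayGradFactorsV1 (Dop_comp_apply)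
open B6Eq2143TwoScaleV1 (QGQs)
open B6Eq235TwoScaleV1 (Hts adjoint_Q_eq reindex reindex_symm_apply hOp_eq hOp_single_apply)
open B6Eq2129TwoScaleV1 (toBondIdx toBondIdx_bijective wLevel wLevel_pos)
open B6SectAVectorModelV1 (GE EE)
open B6SectA (hOp)
open B6Ineq2148TwoScaleV1 (ineq2148_V1_uniform)
open B6Kernel2147DecayV1 (dist_pos_le_of_qpp_ne_zero)
open B6QppKernelV1 (qpp_single_nonneg sum_qpp_single_col)
open Beta.Ineq167OperatorUpper (gamma1)

/-! ## §1  The index set `𝔅`: fibres of the site map, the block bound of `Q″*` -/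

section Index

variable {d L m K : ℕ} {hd : 1 ≤ d + 1} {hL : Odd L ∧ 1 < L} {j : ℕ}
  (Λ' : Finset (Site (⟨d + 1, L, m, K, hd, hL⟩ : Params) (j + 1)))

/-- **at most `2(d + 1)` indices of `𝔅` per site**: the `Λ^c`-bonds `o` with `o₋ = y` (one per direction) and the `Λ′`-bonds `c` whose block
anchor is `y` (one per direction). [cite: Balaban1984PropagatorsII, (2.150) p.249 (bookkeeping, ours)] -/
theorem card_fibre_site_le (hj : j + 1 ≤ m + K) (y : Site (⟨d + 1, L, m, K, hd, hL⟩ : Params) j) :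
    (univ.filter (fun i : CIdx j Λ' => (Sum.elim (fun o : OutBond j Λ' => o.1.src)
          (fun b₁ : InBond j Λ' => Site.blockSite b₁.1.src (fun _ => ⟨0, Params.L_pos _⟩)) :
            CIdx j Λ' → Site (⟨d + 1, L, m, K, hd, hL⟩ : Params) j) i = y)).card ≤ 2 * (d + 1) := by
  classical
  have hjP : j + 1 ≤ (⟨d + 1, L, m, K, hd, hL⟩ : Params).m + (⟨d + 1, L, m, K, hd, hL⟩ : Params).K := hj
  calc (univ.filter (fun i : CIdx j Λ' => (Sum.elim (fun o : OutBond j Λ' => o.1.src)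
        (fun b₁ : InBond j Λ' => Site.blockSite b₁.1.src (fun _ => ⟨0, Params.L_pos _⟩)) :
          CIdx j Λ' → Site (⟨d + 1, L, m, K, hd, hL⟩ : Params) j) i = y)).card
      ≤ (univ : Finset (Fin (d + 1) ⊕ Fin (d + 1))).card :=
        Finset.card_le_card_of_injOn (Sum.map (fun o : OutBond j Λ' => o.1.dir) (fun e : InBond j Λ' => e.1.dir))
          (fun _ _ => Finset.mem_coe.2 (Finset.mem_univ _)) ?_
    _ = 2 * (d + 1) := by rw [Finset.card_univ, Fintype.card_sum, Fintype.card_fin]; ring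
  intro i hi i' hi' h
  have hi₁ := (Finset.mem_filter.1 (Finset.mem_coe.1 hi)).2
  have hi₂ := (Finset.mem_filter.1 (Finset.mem_coe.1 hi')).2
  rcases i with o | e <;> rcases i' with o' | e'
  · simp only [Sum.map_inl, Sum.inl.injEq] at h
    simp only [Sum.elim_inl] at hi₁ hi₂
    obtain ⟨⟨s, μ⟩, ho⟩ := o
    obtain ⟨⟨s', μ'⟩, ho'⟩ := o'
    simp only at h hi₁ hi₂
    subst h; subst hi₁; subst hi₂
    rfl
  · simp at h
  · simp at h
  · simp only [Sum.map_inr, Sum.inr.injEq] at h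
    simp only [Sum.elim_inr] at hi₁ hi₂
    have hs : e.1.src = e'.1.src := by
      rw [← Site.blockOf_blockSite hjP e.1.src (fun _ => ⟨0, Params.L_pos _⟩), hi₁, ← hi₂, Site.blockOf_blockSite hjP]
    obtain ⟨⟨s, μ⟩, he⟩ := e
    obtain ⟨⟨s', μ'⟩, he'⟩ := e'
    simp only at h hs
    subst h; subst hs
    rfl

/-- the position of an index, spelled as in gen 12's `dist_pos_le_of_qpp_ne_zero`. [cite: Balaban1984PropagatorsII, (2.146) p.248] -/
private theorem rep_site_eq (i : CIdx j Λ') : rep (Mk (⟨d + 1, L, m, K, hd, hL⟩ : Params) j) ((Sum.elim (fun o : OutBond j Λ' => o.1.src)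
      (fun b₁ : InBond j Λ' => Site.blockSite b₁.1.src (fun _ => ⟨0, Params.L_pos _⟩)) :
        CIdx j Λ' → Site (⟨d + 1, L, m, K, hd, hL⟩ : Params) j) i) = Sum.elim (fun o : OutBond j Λ' => rep (Mk (⟨d + 1, L, m, K, hd, hL⟩ : Params) j) o.1.src)
    (fun b₁ : InBond j Λ' => rep (Mk (⟨d + 1, L, m, K, hd, hL⟩ : Params) j) (Site.blockSite b₁.1.src (fun _ => ⟨0, Params.L_pos _⟩))) i := by
  cases i <;> rfl

variable [DecidableEq (CIdx j Λ')]

/-- **entry decay on `𝔅` ⇒ block bound** (fibres `≤ 2(d+1)`): `|f(e_{i′})_i| ≤ Ae^{−δ|p(i) − p(i′)|_T}` gives the block bound `(2(d+1)A, δ)`.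
[cite: Balaban1984PropagatorsII, (2.148) p.249, (2.150) p.249 (bookkeeping, ours)] -/
theorem blockBound_of_index_entry (hj : j + 1 ≤ m + K) (f : CSpace j Λ' →ₗ[ℝ] CSpace j Λ') {A δ : ℝ} (hA : 0 ≤ A)
    (hf : ∀ i i' : CIdx j Λ', |f (EuclideanSpace.single i' (1 : ℝ)) i| ≤
      A * Real.exp (-(δ * torusSupNorm (Mk (⟨d + 1, L, m, K, hd, hL⟩ : Params) j) (rep (Mk (⟨d + 1, L, m, K, hd, hL⟩ : Params) j) ((Sum.elim (fun o : OutBond j Λ' => o.1.src)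
            (fun b₁ : InBond j Λ' => Site.blockSite b₁.1.src (fun _ => ⟨0, Params.L_pos _⟩)) :
              CIdx j Λ' → Site (⟨d + 1, L, m, K, hd, hL⟩ : Params) j) i) - rep (Mk (⟨d + 1, L, m, K, hd, hL⟩ : Params) j) ((Sum.elim (fun o : OutBond j Λ' => o.1.src)
            (fun b₁ : InBond j Λ' => Site.blockSite b₁.1.src (fun _ => ⟨0, Params.L_pos _⟩)) :
              CIdx j Λ' → Site (⟨d + 1, L, m, K, hd, hL⟩ : Params) j) i')))))
    (i : CIdx j Λ') (y : Site (⟨d + 1, L, m, K, hd, hL⟩ : Params) j) :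
    ∑ i' ∈ univ.filter (fun i' : CIdx j Λ' => (Sum.elim (fun o : OutBond j Λ' => o.1.src)
          (fun b₁ : InBond j Λ' => Site.blockSite b₁.1.src (fun _ => ⟨0, Params.L_pos _⟩)) :
            CIdx j Λ' → Site (⟨d + 1, L, m, K, hd, hL⟩ : Params) j) i' = y), |f (EuclideanSpace.single i' (1 : ℝ)) i| ≤
      A * (2 * (d + 1) : ℕ) * Real.exp (-(δ * torusSupNorm (Mk (⟨d + 1, L, m, K, hd, hL⟩ : Params) j) (rep (Mk (⟨d + 1, L, m, K, hd, hL⟩ : Params) j) ((Sum.elim (fun o : OutBond j Λ' => o.1.src)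
            (fun b₁ : InBond j Λ' => Site.blockSite b₁.1.src (fun _ => ⟨0, Params.L_pos _⟩)) :
              CIdx j Λ' → Site (⟨d + 1, L, m, K, hd, hL⟩ : Params) j) i) - rep (Mk (⟨d + 1, L, m, K, hd, hL⟩ : Params) j) y))) :=
  blockBound_of_entry (ρ := fun t t' : Site (⟨d + 1, L, m, K, hd, hL⟩ : Params) j => torusSupNorm (Mk (⟨d + 1, L, m, K, hd, hL⟩ : Params) j) (rep (Mk (⟨d + 1, L, m, K, hd, hL⟩ : Params) j) t - rep (Mk (⟨d + 1, L, m, K, hd, hL⟩ : Params) j) t'))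
    f (Sum.elim (fun o : OutBond j Λ' => o.1.src)
          (fun b₁ : InBond j Λ' => Site.blockSite b₁.1.src (fun _ => ⟨0, Params.L_pos _⟩)) :
            CIdx j Λ' → Site (⟨d + 1, L, m, K, hd, hL⟩ : Params) j) (Sum.elim (fun o : OutBond j Λ' => o.1.src)
          (fun b₁ : InBond j Λ' => Site.blockSite b₁.1.src (fun _ => ⟨0, Params.L_pos _⟩)) :
            CIdx j Λ' → Site (⟨d + 1, L, m, K, hd, hL⟩ : Params) j) hA (card_fibre_site_le Λ' hj) hf i y

variable [DecidableEq (PBond (⟨d + 1, L, m, K, hd, hL⟩ : Params) j)]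

omit [DecidableEq (CIdx j Λ')] in
/-- `q_i(b) ≤ 1` (the columns of `Q″` are probability vectors: `q_i ≥ 0`, `Σ_b q_i(b) = 1`). [cite: Balaban1984PropagatorsII, (2.119) p.243] -/
theorem qpp_single_le_one (b : PBond (⟨d + 1, L, m, K, hd, hL⟩ : Params) j) (i : CIdx j Λ') :
    Qpp (⟨d + 1, L, m, K, hd, hL⟩ : Params) j Λ' (EuclideanSpace.single b (1 : ℝ)) i ≤ 1 := by
  exact (Finset.single_le_sum (f := fun b' => Qpp (⟨d + 1, L, m, K, hd, hL⟩ : Params) j Λ' (EuclideanSpace.single b' (1 : ℝ)) i)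
    (fun b' _ => qpp_single_nonneg Λ' b' i) (Finset.mem_univ b)).trans_eq (sum_qpp_single_col Λ' i)

/-- **the entries of `Q″*` decay trivially at every rate**: `|Q″*(e_i)_b| = q_i(b) ≤ e^{δ(2L−1)}·e^{−δ|x_b − p(i)|_T}` for every `δ ≥ 0` (`q_i(b) ≤ 1`
and `q_i(b) ≠ 0 ⇒ |x_b − p(i)|_T ≤ 2L − 1`). [cite: Balaban1984PropagatorsII, (2.146) p.248] -/
theorem Qpp_adjoint_entry_le (hj : j + 1 ≤ m + K) {δ : ℝ} (hδ : 0 ≤ δ) (b : PBond (⟨d + 1, L, m, K, hd, hL⟩ : Params) j) (i : CIdx j Λ') :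
    |LinearMap.adjoint (Qpp (⟨d + 1, L, m, K, hd, hL⟩ : Params) j Λ') (EuclideanSpace.single i (1 : ℝ)) b| ≤
      Real.exp (δ * (2 * (L : ℝ) - 1)) * Real.exp (-(δ * torusSupNorm (Mk (⟨d + 1, L, m, K, hd, hL⟩ : Params) j) (rep (Mk (⟨d + 1, L, m, K, hd, hL⟩ : Params) j) b.src - rep (Mk (⟨d + 1, L, m, K, hd, hL⟩ : Params) j) ((Sum.elim (fun o : OutBond j Λ' => o.1.src)
            (fun b₁ : InBond j Λ' => Site.blockSite b₁.1.src (fun _ => ⟨0, Params.L_pos _⟩)) :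
              CIdx j Λ' → Site (⟨d + 1, L, m, K, hd, hL⟩ : Params) j) i)))) := by
  rw [adjoint_entry]
  by_cases h0 : Qpp (⟨d + 1, L, m, K, hd, hL⟩ : Params) j Λ' (EuclideanSpace.single b (1 : ℝ)) i = 0
  · rw [h0, abs_zero]; positivity
  · have hdist := dist_pos_le_of_qpp_ne_zero Λ' hj i b h0
    rw [← rep_site_eq Λ' i] at hdist
    rw [abs_of_nonneg (qpp_single_nonneg Λ' b i)]
    calc Qpp (⟨d + 1, L, m, K, hd, hL⟩ : Params) j Λ' (EuclideanSpace.single b (1 : ℝ)) i ≤ 1 := qpp_single_le_one Λ' b i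
      _ = Real.exp (δ * (2 * (L : ℝ) - 1)) * Real.exp (-(δ * (2 * (L : ℝ) - 1))) := by
          rw [← Real.exp_add, add_neg_cancel, Real.exp_zero]
      _ ≤ _ := mul_le_mul_of_nonneg_left (Real.exp_le_exp.2 (neg_le_neg (mul_le_mul_of_nonneg_left hdist hδ))) (Real.exp_pos _).le

/-- **`Q″*` HAS THE BLOCK BOUND `(2(d+1)e^{δ(2L−1)}, δ)` FOR EVERY `δ ≥ 0`** (unit bonds ← indices placed at their sites).
[cite: Balaban1984PropagatorsII, (2.146) p.248, (2.150) p.249 (bookkeeping, ours)] -/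
theorem blockBound_Qpp_adjoint (hj : j + 1 ≤ m + K) {δ : ℝ} (hδ : 0 ≤ δ) (b : PBond (⟨d + 1, L, m, K, hd, hL⟩ : Params) j)
    (y : Site (⟨d + 1, L, m, K, hd, hL⟩ : Params) j) :
    ∑ i ∈ univ.filter (fun i : CIdx j Λ' => (Sum.elim (fun o : OutBond j Λ' => o.1.src)
          (fun b₁ : InBond j Λ' => Site.blockSite b₁.1.src (fun _ => ⟨0, Params.L_pos _⟩)) :
            CIdx j Λ' → Site (⟨d + 1, L, m, K, hd, hL⟩ : Params) j) i = y),
        |LinearMap.adjoint (Qpp (⟨d + 1, L, m, K, hd, hL⟩ : Params) j Λ') (EuclideanSpace.single i (1 : ℝ)) b| ≤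
      Real.exp (δ * (2 * (L : ℝ) - 1)) * (2 * (d + 1) : ℕ) * Real.exp (-(δ * torusSupNorm (Mk (⟨d + 1, L, m, K, hd, hL⟩ : Params) j) (rep (Mk (⟨d + 1, L, m, K, hd, hL⟩ : Params) j) b.src - rep (Mk (⟨d + 1, L, m, K, hd, hL⟩ : Params) j) y))) :=
  blockBound_of_entry (ρ := fun t t' : Site (⟨d + 1, L, m, K, hd, hL⟩ : Params) j => torusSupNorm (Mk (⟨d + 1, L, m, K, hd, hL⟩ : Params) j) (rep (Mk (⟨d + 1, L, m, K, hd, hL⟩ : Params) j) t - rep (Mk (⟨d + 1, L, m, K, hd, hL⟩ : Params) j) t'))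
    (LinearMap.adjoint (Qpp (⟨d + 1, L, m, K, hd, hL⟩ : Params) j Λ')) (fun b : PBond (⟨d + 1, L, m, K, hd, hL⟩ : Params) j => b.src) (Sum.elim (fun o : OutBond j Λ' => o.1.src)
          (fun b₁ : InBond j Λ' => Site.blockSite b₁.1.src (fun _ => ⟨0, Params.L_pos _⟩)) :
            CIdx j Λ' → Site (⟨d + 1, L, m, K, hd, hL⟩ : Params) j)
    (Real.exp_pos _).le (card_fibre_site_le Λ' hj) (fun b i => Qpp_adjoint_entry_le Λ' hj hδ b i) b y

end Index

/-! ## §2  The block bound of `Q* = Q_j*Q″*` (fine bonds ← indices) at every rate -/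

section QAdjoint

variable {d L m K : ℕ} {hd : 1 ≤ d + 1} {hL : Odd L ∧ 1 < L} {c : ℝ} (hc : c ≠ 0) {j : ℕ}
  (Λ' : Finset (Site (⟨d + 1, L, m, K, hd, hL⟩ : Params) (j + 1))) {w : CIdx j Λ' → ℝ}
  [DecidableEq (PBond (⟨d + 1, L, m, K, hd, hL⟩ : Params) 0)] [DecidableEq (PBond (⟨d + 1, L, m, K, hd, hL⟩ : Params) j)]
  [DecidableEq (CIdx j Λ')]

/-- **`Q*` HAS THE BLOCK BOUND `(η^{d+1}e^{δ+1}·2(d+1)e^{δ(2L−1)}·K_{d+1}(1), δ)` FOR EVERY `δ ≥ 0`** (fine bonds ← indices): `Q_j*` at rate `δ + 1`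
(gen 16) composed with `Q″*` at rate `δ` (§1), no volume factor. [cite: Balaban1984PropagatorsII, (2.144) p.248, (2.150) p.249 (bookkeeping, ours)] -/
theorem blockBound_Q_adjoint (hj : j + 1 ≤ m + K) {δ : ℝ} (hδ : 0 ≤ δ) (b₀ : PBond (⟨d + 1, L, m, K, hd, hL⟩ : Params) 0)
    (y : Site (⟨d + 1, L, m, K, hd, hL⟩ : Params) j) :
    ∑ i ∈ univ.filter (fun i : CIdx j Λ' => (Sum.elim (fun o : OutBond j Λ' => o.1.src)
          (fun b₁ : InBond j Λ' => Site.blockSite b₁.1.src (fun _ => ⟨0, Params.L_pos _⟩)) :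
            CIdx j Λ' → Site (⟨d + 1, L, m, K, hd, hL⟩ : Params) j) i = y), |LinearMap.adjoint (tsV1 hc Λ' w).Q (EuclideanSpace.single i (1 : ℝ)) b₀| ≤
      (⟨d + 1, L, m, K, hd, hL⟩ : Params).eta j ^ (d + 1) * Real.exp (δ + 1) * (Real.exp (δ * (2 * (L : ℝ) - 1)) * (2 * (d + 1) : ℕ)) *
          latticeConst (d + 1) 1 *
        Real.exp (-(δ * torusSupNorm (Mk (⟨d + 1, L, m, K, hd, hL⟩ : Params) j) (rep (Mk (⟨d + 1, L, m, K, hd, hL⟩ : Params) j) (iterBlockOf j b₀.src) - rep (Mk (⟨d + 1, L, m, K, hd, hL⟩ : Params) j) y))) := by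
  have hjP : j ≤ (⟨d + 1, L, m, K, hd, hL⟩ : Params).m + (⟨d + 1, L, m, K, hd, hL⟩ : Params).K := Nat.le_of_succ_le hj
  have hη : 0 ≤ (⟨d + 1, L, m, K, hd, hL⟩ : Params).eta j ^ (d + 1) := pow_nonneg (pow_nonneg (inv_nonneg.mpr (Nat.cast_nonneg _)) _) _
  rw [adjoint_Q_eq]
  have h := blockBound_comp (KY := fun a => latticeConst (d + 1) a) (torusDist_isPseudoDist (Mk (⟨d + 1, L, m, K, hd, hL⟩ : Params) j)) (torusDist_sumBound (Mk (⟨d + 1, L, m, K, hd, hL⟩ : Params) j))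
    (LinearMap.adjoint (tsV1 hc Λ' w).Qv) (LinearMap.adjoint (Qpp (⟨d + 1, L, m, K, hd, hL⟩ : Params) j Λ'))
    (fun b₀ : PBond (⟨d + 1, L, m, K, hd, hL⟩ : Params) 0 => iterBlockOf j b₀.src)
    (fun b : PBond (⟨d + 1, L, m, K, hd, hL⟩ : Params) j => b.src) (Sum.elim (fun o : OutBond j Λ' => o.1.src)
          (fun b₁ : InBond j Λ' => Site.blockSite b₁.1.src (fun _ => ⟨0, Params.L_pos _⟩)) :
            CIdx j Λ' → Site (⟨d + 1, L, m, K, hd, hL⟩ : Params) j)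
    (Cf := (⟨d + 1, L, m, K, hd, hL⟩ : Params).eta j ^ (d + 1) * Real.exp (δ + 1))
    (Cg := Real.exp (δ * (2 * (L : ℝ) - 1)) * (2 * (d + 1) : ℕ)) (a := δ + 1) (b := δ) (δ' := δ)
    (by positivity) (by positivity) hδ le_rfl (by linarith)
    (fun b₀ y' => blockBound_Qv_adjoint hc hjP Λ' w (by linarith : (0 : ℝ) ≤ δ + 1) b₀ y')
    (fun b y' => blockBound_Qpp_adjoint Λ' hj hδ b y') b₀ y
  rw [add_sub_cancel_left] at h
  exact h

end QAdjoint

/-! ## §3  The factor `Q*(QGQ*)⁻¹` (fine bonds ← indices): its uniform block bound at `c = L^j` -/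

section Uniform

open Classical in
/-- **THE BLOCK BOUND OF `Q*(QGQ*)⁻¹`, UNIFORMLY** (`c = L^j`, weights `a₀n^{d+1} ≤ w ≤ a₁n^{d+1}`): there are `δ₄ > 0`, `C ≥ 0` depending on
`d, L, a₀, a₁` only such that for every volume, `j + 1 ≤ m + K`, `Λ′`, weights of the window, fine bond `b₀` and unit site `y`:
`Σ_{c ∈ 𝔅 : site(c) = y}|(Q*(QGQ*)⁻¹)(e_c)_{b₀}| ≤ C·e^{−δ₄|y(b₀₋) − y|_T}` — §2's `Q*` at the free rate `δ₄ + 1` (constant `O(1)η^{d+1}`) composed with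
(2.148)'s entry decay of `(QGQ*)⁻¹` (`…B6Ineq2148TwoScaleV1.ineq2148_V1_uniform`: rate `δ₄`, constant `O(1)κ = O(1)n^{d+1}` at `c = L^j`); the
`η^{d+1}` cancels the `n^{d+1}` (`η = n⁻¹`), no volume factor. [cite: Balaban1984PropagatorsII, (2.148) p.249, (2.150) p.249] -/
theorem blockBound_QsRinv_scaling (d L : ℕ) (hd : 1 ≤ d + 1) (hL : Odd L ∧ 1 < L) {a₀ a₁ : ℝ} (ha₀ : 0 < a₀) (ha₁ : a₀ ≤ a₁) :
    ∃ δ : ℝ, 0 < δ ∧ ∃ C : ℝ, 0 ≤ C ∧ ∀ (m K : ℕ) (j : ℕ) (hc : ((L : ℝ) ^ j) ≠ 0)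
      (_hj : j + 1 ≤ (⟨d + 1, L, m, K, hd, hL⟩ : Params).m + (⟨d + 1, L, m, K, hd, hL⟩ : Params).K)
      (Λ' : Finset (Site (⟨d + 1, L, m, K, hd, hL⟩ : Params) (j + 1))) (w : CIdx j Λ' → ℝ)
      (_hw0 : ∀ i, a₀ * ((L : ℝ) ^ j) ^ (d + 1) ≤ w i) (_hw1 : ∀ i, w i ≤ a₁ * ((L : ℝ) ^ j) ^ (d + 1))
      (b₀ : PBond (⟨d + 1, L, m, K, hd, hL⟩ : Params) 0) (y : Site (⟨d + 1, L, m, K, hd, hL⟩ : Params) j),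
      ∑ i ∈ univ.filter (fun i : CIdx j Λ' => (Sum.elim (fun o : OutBond j Λ' => o.1.src)
            (fun b₁ : InBond j Λ' => Site.blockSite b₁.1.src (fun _ => ⟨0, Params.L_pos _⟩)) :
              CIdx j Λ' → Site (⟨d + 1, L, m, K, hd, hL⟩ : Params) j) i = y),
          |(LinearMap.adjoint (tsV1 hc Λ' w).Q ∘ₗ Ring.inverse (QGQs hc Λ' (w := w))) (EuclideanSpace.single i (1 : ℝ)) b₀| ≤
        C * Real.exp (-(δ * torusSupNorm (Mk (⟨d + 1, L, m, K, hd, hL⟩ : Params) j) (rep (Mk (⟨d + 1, L, m, K, hd, hL⟩ : Params) j) (iterBlockOf j b₀.src) - rep (Mk (⟨d + 1, L, m, K, hd, hL⟩ : Params) j) y))) := by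
  obtain ⟨δ₄, hδ₄, hR⟩ := ineq2148_V1_uniform d L hd hL ha₀ ha₁
  -- the constants (all depending on `d, L, a₀, a₁` only)
  set g₀ : ℝ := (a₁ * (1 + ((L : ℝ) ^ (d + 1))⁻¹) + gamma1 (d + 1) * (8 * (d + 1 : ℕ)))⁻¹ *
    (2 + 4 * (L : ℝ) ^ 2 + (L : ℝ) ^ (d + 1 + 2))⁻¹ with hg₀
  set CQ : ℝ := Real.exp (δ₄ + 1 + 1) * (Real.exp ((δ₄ + 1) * (2 * (L : ℝ) - 1)) * (2 * (d + 1) : ℕ)) * latticeConst (d + 1) 1 with hCQ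
  set CR : ℝ := 2 / g₀ * (2 * (d + 1) : ℕ) with hCR
  have hLpos : (0 : ℝ) < L := by exact_mod_cast (lt_trans Nat.zero_lt_one hL.2)
  have hγ1 : 0 < gamma1 (d + 1) := Beta.Ineq167OperatorUpper.gamma1_pos (d + 1)
  have ha₁0 : 0 < a₁ := ha₀.trans_le ha₁
  have hg : 0 < g₀ := by positivity
  have hK1 : 0 ≤ latticeConst (d + 1) 1 := latticeConst_nonneg _ zero_le_one
  have hCQ0 : 0 ≤ CQ := by positivity
  have hCR0 : 0 ≤ CR := by positivity
  refine ⟨δ₄, hδ₄, CQ * CR * latticeConst (d + 1) 1, by positivity, fun m K j hc hj Λ' w hw0 hw1 b₀ y => ?_⟩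
  have hjmK : j + 1 ≤ m + K := hj
  have hη : 0 ≤ (⟨d + 1, L, m, K, hd, hL⟩ : Params).eta j ^ (d + 1) := pow_nonneg (pow_nonneg (inv_nonneg.mpr (Nat.cast_nonneg _)) _) _
  have hn : (0 : ℝ) < ((L : ℝ) ^ j) ^ (d + 1) := by positivity
  -- at `c = L^j`: `κ = c²/(η^{d+1}n²) = n^{d+1}` and `η^{d+1}n^{d+1} = 1`
  have hκ : ((L : ℝ) ^ j) ^ 2 / (eta L j ^ (d + 1) * ((L : ℝ) ^ j) ^ 2) = ((L : ℝ) ^ j) ^ (d + 1) := by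
    rw [eta, inv_pow, div_eq_iff (by positivity)]
    field_simp
  have hηn : (⟨d + 1, L, m, K, hd, hL⟩ : Params).eta j ^ (d + 1) * ((L : ℝ) ^ j) ^ (d + 1) = 1 := by
    rw [← mul_pow, Params.eta, inv_pow]
    show (((L : ℝ) ^ j)⁻¹ * (L : ℝ) ^ j) ^ (d + 1) = 1
    rw [inv_mul_cancel₀ (pow_ne_zero _ hLpos.ne'), one_pow]
  -- (2.148): the entries of `(QGQ*)⁻¹`; the prefactor `2/γ₀ = n^{d+1}·(2/g₀)`
  have hAR : 2 / ((a₁ * ((L : ℝ) ^ j) ^ (d + 1) * (1 + ((L : ℝ) ^ (d + 1))⁻¹) +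
      ((L : ℝ) ^ j) ^ (d + 1) * (gamma1 (d + 1) * (8 * (d + 1 : ℕ))))⁻¹ * (2 + 4 * (L : ℝ) ^ 2 + (L : ℝ) ^ (d + 1 + 2))⁻¹) =
      ((L : ℝ) ^ j) ^ (d + 1) * (2 / g₀) := by
    rw [hg₀]
    set S : ℝ := a₁ * (1 + ((L : ℝ) ^ (d + 1))⁻¹) + gamma1 (d + 1) * (8 * (d + 1 : ℕ)) with hS
    set T : ℝ := 2 + 4 * (L : ℝ) ^ 2 + (L : ℝ) ^ (d + 1 + 2) with hT
    have h1 : a₁ * ((L : ℝ) ^ j) ^ (d + 1) * (1 + ((L : ℝ) ^ (d + 1))⁻¹) + ((L : ℝ) ^ j) ^ (d + 1) * (gamma1 (d + 1) * (8 * (d + 1 : ℕ))) =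
        ((L : ℝ) ^ j) ^ (d + 1) * S := by rw [hS]; ring
    rw [h1]
    simp only [mul_inv, inv_inv, div_eq_mul_inv]
    ring
  have hRe : ∀ i i' : CIdx j Λ', |Ring.inverse (QGQs hc Λ' (w := w)) (EuclideanSpace.single i' (1 : ℝ)) i| ≤
      ((L : ℝ) ^ j) ^ (d + 1) * (2 / g₀) * Real.exp (-(δ₄ * torusSupNorm (Mk (⟨d + 1, L, m, K, hd, hL⟩ : Params) j) (rep (Mk (⟨d + 1, L, m, K, hd, hL⟩ : Params) j) ((Sum.elim (fun o : OutBond j Λ' => o.1.src)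
            (fun b₁ : InBond j Λ' => Site.blockSite b₁.1.src (fun _ => ⟨0, Params.L_pos _⟩)) :
              CIdx j Λ' → Site (⟨d + 1, L, m, K, hd, hL⟩ : Params) j) i) - rep (Mk (⟨d + 1, L, m, K, hd, hL⟩ : Params) j) ((Sum.elim (fun o : OutBond j Λ' => o.1.src)
            (fun b₁ : InBond j Λ' => Site.blockSite b₁.1.src (fun _ => ⟨0, Params.L_pos _⟩)) :
              CIdx j Λ' → Site (⟨d + 1, L, m, K, hd, hL⟩ : Params) j) i')))) := fun i i' => by
    have h := hR m K ((L : ℝ) ^ j) hc j hjmK Λ' w (fun k => by rw [hκ]; exact hw0 k) (fun k => by rw [hκ]; exact hw1 k) i i'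
    rw [EuclideanSpace.inner_single_left, conj_trivial, one_mul, hκ, hAR] at h
    exact h
  have hRb := blockBound_of_index_entry Λ' hjmK (Ring.inverse (QGQs hc Λ' (w := w))) (by positivity) hRe
  -- `Q*` at rate `δ₄ + 1`, then the composition at rate `δ₄` (no halving: the rate of `Q*` is free)
  have hQb : ∀ (b₀ : PBond (⟨d + 1, L, m, K, hd, hL⟩ : Params) 0) (y' : Site (⟨d + 1, L, m, K, hd, hL⟩ : Params) j),
      ∑ i ∈ univ.filter (fun i : CIdx j Λ' => (Sum.elim (fun o : OutBond j Λ' => o.1.src)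
            (fun b₁ : InBond j Λ' => Site.blockSite b₁.1.src (fun _ => ⟨0, Params.L_pos _⟩)) :
              CIdx j Λ' → Site (⟨d + 1, L, m, K, hd, hL⟩ : Params) j) i = y'), |LinearMap.adjoint (tsV1 hc Λ' w).Q (EuclideanSpace.single i (1 : ℝ)) b₀| ≤
        (⟨d + 1, L, m, K, hd, hL⟩ : Params).eta j ^ (d + 1) * CQ *
          Real.exp (-((δ₄ + 1) * torusSupNorm (Mk (⟨d + 1, L, m, K, hd, hL⟩ : Params) j) (rep (Mk (⟨d + 1, L, m, K, hd, hL⟩ : Params) j) (iterBlockOf j b₀.src) - rep (Mk (⟨d + 1, L, m, K, hd, hL⟩ : Params) j) y'))) := fun b₀ y' => by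
    have h := blockBound_Q_adjoint hc Λ' (w := w) hjmK (δ := δ₄ + 1) (by positivity) b₀ y'
    rw [hCQ]
    refine h.trans (le_of_eq ?_)
    ring
  have hQR := blockBound_comp (KY := fun a => latticeConst (d + 1) a) (torusDist_isPseudoDist (Mk (⟨d + 1, L, m, K, hd, hL⟩ : Params) j)) (torusDist_sumBound (Mk (⟨d + 1, L, m, K, hd, hL⟩ : Params) j))
    (LinearMap.adjoint (tsV1 hc Λ' w).Q) (Ring.inverse (QGQs hc Λ' (w := w)))
    (fun b₀ : PBond (⟨d + 1, L, m, K, hd, hL⟩ : Params) 0 => iterBlockOf j b₀.src) (Sum.elim (fun o : OutBond j Λ' => o.1.src)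
          (fun b₁ : InBond j Λ' => Site.blockSite b₁.1.src (fun _ => ⟨0, Params.L_pos _⟩)) :
            CIdx j Λ' → Site (⟨d + 1, L, m, K, hd, hL⟩ : Params) j) (Sum.elim (fun o : OutBond j Λ' => o.1.src)
          (fun b₁ : InBond j Λ' => Site.blockSite b₁.1.src (fun _ => ⟨0, Params.L_pos _⟩)) :
            CIdx j Λ' → Site (⟨d + 1, L, m, K, hd, hL⟩ : Params) j)
    (Cf := (⟨d + 1, L, m, K, hd, hL⟩ : Params).eta j ^ (d + 1) * CQ) (Cg := ((L : ℝ) ^ j) ^ (d + 1) * (2 / g₀) * (2 * (d + 1) : ℕ))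
    (a := δ₄ + 1) (b := δ₄) (δ' := δ₄) (by positivity) (by positivity) hδ₄.le le_rfl (by linarith) hQb hRb b₀ y
  rw [add_sub_cancel_left] at hQR
  refine hQR.trans (le_of_eq ?_)
  rw [hCR]
  have : (⟨d + 1, L, m, K, hd, hL⟩ : Params).eta j ^ (d + 1) * CQ * (((L : ℝ) ^ j) ^ (d + 1) * (2 / g₀) * (2 * (d + 1) : ℕ)) *
      latticeConst (d + 1) 1 = ((⟨d + 1, L, m, K, hd, hL⟩ : Params).eta j ^ (d + 1) * ((L : ℝ) ^ j) ^ (d + 1)) *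
        (CQ * (2 / g₀ * (2 * (d + 1) : ℕ)) * latticeConst (d + 1) 1) := by ring
  rw [this, hηn, one_mul]

/-! ## §4  Corollary 2.8, the member `|H(b, c)|`: the block bound of `H = G·Q*(QGQ*)⁻¹` and the printed shape -/

open Classical in
/-- **COROLLARY 2.8, THE DECAY OF `H = GQ*(QGQ*)⁻¹` AS A BLOCK BOUND** (two-scale data `tsV1`, `c = L^j`, weights `a₀n^{d+1} ≤ w ≤ a₁n^{d+1}`):
there are `δ₅ > 0`, `C ≥ 0` depending on `d, L, a₀, a₁` only such that for every volume `(m, K)`, every `j + 1 ≤ m + K`, every `Λ′ ⊂ T^{(j+1)}`,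
all weights of the window, all fine bonds `b₀` and unit sites `y`: `Σ_{c ∈ 𝔅 : site(c) = y}|H(e_c)_{b₀}| ≤ C·e^{−δ₅|y(b₀₋) − y|_T}` — Prop. 2.5's
block bound of `G` (`…B6Prop25DecayTwoScaleV1.blockBound_G_scaling`, rate `δ₂`) composed with §3 (rate `δ₄`) at the rate `min(δ₂/2, δ₄)`.
[cite: Balaban1984PropagatorsII, Cor. 2.8 (2.151) p.249] -/
theorem blockBound_Hts_scaling (d L : ℕ) (hd : 1 ≤ d + 1) (hL : Odd L ∧ 1 < L) {a₀ a₁ : ℝ} (ha₀ : 0 < a₀) (ha₁ : a₀ ≤ a₁) :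
    ∃ δ : ℝ, 0 < δ ∧ ∃ C : ℝ, 0 ≤ C ∧ ∀ (m K : ℕ) (j : ℕ) (hc : ((L : ℝ) ^ j) ≠ 0)
      (_hj : j + 1 ≤ (⟨d + 1, L, m, K, hd, hL⟩ : Params).m + (⟨d + 1, L, m, K, hd, hL⟩ : Params).K)
      (Λ' : Finset (Site (⟨d + 1, L, m, K, hd, hL⟩ : Params) (j + 1))) (w : CIdx j Λ' → ℝ)
      (_hw0 : ∀ i, a₀ * ((L : ℝ) ^ j) ^ (d + 1) ≤ w i) (_hw1 : ∀ i, w i ≤ a₁ * ((L : ℝ) ^ j) ^ (d + 1))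
      (b₀ : PBond (⟨d + 1, L, m, K, hd, hL⟩ : Params) 0) (y : Site (⟨d + 1, L, m, K, hd, hL⟩ : Params) j),
      ∑ i ∈ univ.filter (fun i : CIdx j Λ' => (Sum.elim (fun o : OutBond j Λ' => o.1.src)
            (fun b₁ : InBond j Λ' => Site.blockSite b₁.1.src (fun _ => ⟨0, Params.L_pos _⟩)) :
              CIdx j Λ' → Site (⟨d + 1, L, m, K, hd, hL⟩ : Params) j) i = y), |Hts hc Λ' (w := w) (EuclideanSpace.single i (1 : ℝ)) b₀| ≤
        C * Real.exp (-(δ * torusSupNorm (Mk (⟨d + 1, L, m, K, hd, hL⟩ : Params) j) (rep (Mk (⟨d + 1, L, m, K, hd, hL⟩ : Params) j) (iterBlockOf j b₀.src) - rep (Mk (⟨d + 1, L, m, K, hd, hL⟩ : Params) j) y))) := by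
  obtain ⟨δ₂, hδ₂, C₂, hC₂, hG⟩ := blockBound_G_scaling d L hd hL ha₀ ha₁
  obtain ⟨δ₄, hδ₄, C₄, hC₄, hQR⟩ := blockBound_QsRinv_scaling d L hd hL ha₀ ha₁
  have hδH4 : min (δ₂ / 2) δ₄ ≤ δ₄ := min_le_right _ _
  have hδH2 : min (δ₂ / 2) δ₄ < δ₂ := (min_le_left _ _).trans_lt (half_lt_self hδ₂)
  have hKH : 0 ≤ latticeConst (d + 1) (δ₂ - min (δ₂ / 2) δ₄) := latticeConst_nonneg _ (by linarith)
  refine ⟨min (δ₂ / 2) δ₄, lt_min (half_pos hδ₂) hδ₄, C₂ * C₄ * latticeConst (d + 1) (δ₂ - min (δ₂ / 2) δ₄), by positivity,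
    fun m K j hc hj Λ' w hw0 hw1 b₀ y => ?_⟩
  exact blockBound_comp (KY := fun a => latticeConst (d + 1) a) (torusDist_isPseudoDist (Mk (⟨d + 1, L, m, K, hd, hL⟩ : Params) j)) (torusDist_sumBound (Mk (⟨d + 1, L, m, K, hd, hL⟩ : Params) j))
    (tsV1 hc Λ' w).G (LinearMap.adjoint (tsV1 hc Λ' w).Q ∘ₗ Ring.inverse (QGQs hc Λ' (w := w)))
    (fun b₀ : PBond (⟨d + 1, L, m, K, hd, hL⟩ : Params) 0 => iterBlockOf j b₀.src)
    (fun b₀ : PBond (⟨d + 1, L, m, K, hd, hL⟩ : Params) 0 => iterBlockOf j b₀.src) (Sum.elim (fun o : OutBond j Λ' => o.1.src)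
          (fun b₁ : InBond j Λ' => Site.blockSite b₁.1.src (fun _ => ⟨0, Params.L_pos _⟩)) :
            CIdx j Λ' → Site (⟨d + 1, L, m, K, hd, hL⟩ : Params) j)
    hC₂ hC₄ (lt_min (half_pos hδ₂) hδ₄).le hδH4 hδH2 (hG m K j hc hj Λ' w hw0 hw1) (hQR m K j hc hj Λ' w hw0 hw1) b₀ y

open Classical in
/-- **COROLLARY 2.8, (2.151)₁ IN THE PRINTED SHAPE**: there are `δ₅ > 0`, `C ≥ 0` depending on `d, L, a₀, a₁` only such that for every volume,
`j + 1 ≤ m + K`, `Λ′`, weights of the window, every radius `r ≥ 0`, every `B ∈ L²(𝔅)` supported on the indices sited within `r` of `y′` with `|B| ≤ X`,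
and every fine bond `b₀` over the unit sites within `r` of `y`: `|(HB)(b₀)| ≤ C·e^{(1+2δ₅)r}·e^{−δ₅|y − y′|_T}·X` — print's *«|H(b,c)| ≦ O(1)(L^{j′}η)^{−d}
e^{−δ₅d(y,c₋)}, b ∈ Δ(y), c₋ ∈ Λ_{j′}»* with the kernel normalisation (2.150) `(HB)(b) = Σ_c (L^{j(c)}η)^dH(b,c)B(c)` absorbed (our entries are the
unweighted `ℓ²` ones, `= (L^{j(c)}η)^dH(b,c)`). [cite: Balaban1984PropagatorsII, Cor. 2.8 (2.150)–(2.151) p.249] -/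
theorem cor28_ineq2151_H (d L : ℕ) (hd : 1 ≤ d + 1) (hL : Odd L ∧ 1 < L) {a₀ a₁ : ℝ} (ha₀ : 0 < a₀) (ha₁ : a₀ ≤ a₁) :
    ∃ δ : ℝ, 0 < δ ∧ ∃ C : ℝ, 0 ≤ C ∧ ∀ (m K : ℕ) (j : ℕ) (hc : ((L : ℝ) ^ j) ≠ 0)
      (_hj : j + 1 ≤ (⟨d + 1, L, m, K, hd, hL⟩ : Params).m + (⟨d + 1, L, m, K, hd, hL⟩ : Params).K)
      (Λ' : Finset (Site (⟨d + 1, L, m, K, hd, hL⟩ : Params) (j + 1))) (w : CIdx j Λ' → ℝ)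
      (_hw0 : ∀ i, a₀ * ((L : ℝ) ^ j) ^ (d + 1) ≤ w i) (_hw1 : ∀ i, w i ≤ a₁ * ((L : ℝ) ^ j) ^ (d + 1))
      (r : ℝ) (_hr : 0 ≤ r) (B : CSpace j Λ') (X : ℝ) (_hX : 0 ≤ X) (y y' : Site (⟨d + 1, L, m, K, hd, hL⟩ : Params) j)
      (_hsupp : ∀ i : CIdx j Λ', B i ≠ 0 → torusSupNorm (Mk (⟨d + 1, L, m, K, hd, hL⟩ : Params) j) (rep (Mk (⟨d + 1, L, m, K, hd, hL⟩ : Params) j) ((Sum.elim (fun o : OutBond j Λ' => o.1.src)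
            (fun b₁ : InBond j Λ' => Site.blockSite b₁.1.src (fun _ => ⟨0, Params.L_pos _⟩)) :
              CIdx j Λ' → Site (⟨d + 1, L, m, K, hd, hL⟩ : Params) j) i) - rep (Mk (⟨d + 1, L, m, K, hd, hL⟩ : Params) j) y') ≤ r) (_hB : ∀ i : CIdx j Λ', |B i| ≤ X)
      (b₀ : PBond (⟨d + 1, L, m, K, hd, hL⟩ : Params) 0) (_hb₀ : torusSupNorm (Mk (⟨d + 1, L, m, K, hd, hL⟩ : Params) j) (rep (Mk (⟨d + 1, L, m, K, hd, hL⟩ : Params) j) (iterBlockOf j b₀.src) - rep (Mk (⟨d + 1, L, m, K, hd, hL⟩ : Params) j) y) ≤ r),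
      |Hts hc Λ' (w := w) B b₀| ≤ C * Real.exp ((1 + 2 * δ) * r) * Real.exp (-(δ * torusSupNorm (Mk (⟨d + 1, L, m, K, hd, hL⟩ : Params) j) (rep (Mk (⟨d + 1, L, m, K, hd, hL⟩ : Params) j) y - rep (Mk (⟨d + 1, L, m, K, hd, hL⟩ : Params) j) y'))) * X := by
  obtain ⟨δ, hδ, C, hC, h⟩ := blockBound_Hts_scaling d L hd hL ha₀ ha₁
  refine ⟨δ, hδ, C * latticeConst (d + 1) 1, mul_nonneg hC (latticeConst_nonneg _ zero_le_one), ?_⟩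
  intro m K j hc hj Λ' w hw0 hw1 r hr B X hX y y' hsupp hB b₀ hb₀
  have h' := abs_apply_le_of_support (KY := fun a => latticeConst (d + 1) a) (torusDist_isPseudoDist (Mk (⟨d + 1, L, m, K, hd, hL⟩ : Params) j)) (torusDist_sumBound (Mk (⟨d + 1, L, m, K, hd, hL⟩ : Params) j))
    (Hts hc Λ' (w := w)) (fun b₀ : PBond (⟨d + 1, L, m, K, hd, hL⟩ : Params) 0 => iterBlockOf j b₀.src) (Sum.elim (fun o : OutBond j Λ' => o.1.src)
          (fun b₁ : InBond j Λ' => Site.blockSite b₁.1.src (fun _ => ⟨0, Params.L_pos _⟩)) :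
            CIdx j Λ' → Site (⟨d + 1, L, m, K, hd, hL⟩ : Params) j) hC hδ.le hX
    (h m K j hc hj Λ' w hw0 hw1) B y y' hsupp hB b₀ hb₀
  refine h'.trans (le_of_eq ?_)
  ring

/-! ## §5  Corollary 2.8, the member `|(∇H)(b, c)|`: the block bound of `D_λH` and the printed shape -/

/-- `D·H = (D·G)·(Q*(QGQ*)⁻¹)` for every linear `D` on fine bond fields (reassociation). [cite: Balaban1984PropagatorsII, (2.150) p.249 (plumbing)] -/
private theorem comp_Hts_eq {P : Params} {c : ℝ} (hc : c ≠ 0) {j : ℕ} (Λ' : Finset (Site P (j + 1))) {w : CIdx j Λ' → ℝ}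
    (D : BondSpace P →ₗ[ℝ] BondSpace P) :
    D ∘ₗ Hts hc Λ' (w := w) = (D ∘ₗ (tsV1 hc Λ' w).G) ∘ₗ (LinearMap.adjoint (tsV1 hc Λ' w).Q ∘ₗ Ring.inverse (QGQs hc Λ' (w := w))) :=
  rfl

open Classical in
/-- **COROLLARY 2.8, THE DECAY OF `∇H` AS A BLOCK BOUND** (`D_λ = n(S_λ − 1)`, the forward difference quotient of the fine `ξ`-lattice, `ξ = L^{−j}`):
there are `δ₅ > 0`, `C ≥ 0` depending on `d, L, a₀, a₁` only such that for every volume, `j + 1 ≤ m + K`, `Λ′`, weights of the window, direction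
`λ`, fine bond `b₀` and unit site `y`: `Σ_{c ∈ 𝔅 : site(c) = y}|(D_λH)(e_c)_{b₀}| ≤ C·e^{−δ₅|y(b₀₋) − y|_T}` — Prop. 2.5's block bound of `D_λG`
(`…B6Prop25GradDecayTwoScaleV1.blockBound_DG_scaling`) composed with §3. [cite: Balaban1984PropagatorsII, Cor. 2.8 (2.151) p.249;
Balaban1984PropagatorsI, (1.110) p.35] -/
theorem blockBound_DHts_scaling (d L : ℕ) (hd : 1 ≤ d + 1) (hL : Odd L ∧ 1 < L) {a₀ a₁ : ℝ} (ha₀ : 0 < a₀) (ha₁ : a₀ ≤ a₁) :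
    ∃ δ : ℝ, 0 < δ ∧ ∃ C : ℝ, 0 ≤ C ∧ ∀ (m K : ℕ) (j : ℕ) (hc : ((L : ℝ) ^ j) ≠ 0)
      (_hj : j + 1 ≤ (⟨d + 1, L, m, K, hd, hL⟩ : Params).m + (⟨d + 1, L, m, K, hd, hL⟩ : Params).K)
      (Λ' : Finset (Site (⟨d + 1, L, m, K, hd, hL⟩ : Params) (j + 1))) (w : CIdx j Λ' → ℝ)
      (_hw0 : ∀ i, a₀ * ((L : ℝ) ^ j) ^ (d + 1) ≤ w i) (_hw1 : ∀ i, w i ≤ a₁ * ((L : ℝ) ^ j) ^ (d + 1)) (lam : Fin (d + 1))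
      (b₀ : PBond (⟨d + 1, L, m, K, hd, hL⟩ : Params) 0) (y : Site (⟨d + 1, L, m, K, hd, hL⟩ : Params) j),
      ∑ i ∈ univ.filter (fun i : CIdx j Λ' => (Sum.elim (fun o : OutBond j Λ' => o.1.src)
            (fun b₁ : InBond j Λ' => Site.blockSite b₁.1.src (fun _ => ⟨0, Params.L_pos _⟩)) :
              CIdx j Λ' → Site (⟨d + 1, L, m, K, hd, hL⟩ : Params) j) i = y),
          |(((((L : ℝ) ^ j) • (onE (LinearMap.funLeft ℝ ℝ (fun b : PBond (⟨d + 1, L, m, K, hd, hL⟩ : Params) 0 =>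
              (⟨b.src.shift lam, b.dir⟩ : PBond (⟨d + 1, L, m, K, hd, hL⟩ : Params) 0))) - LinearMap.id) :
            BondSpace (⟨d + 1, L, m, K, hd, hL⟩ : Params) →ₗ[ℝ] BondSpace (⟨d + 1, L, m, K, hd, hL⟩ : Params))) ∘ₗ Hts hc Λ' (w := w))
            (EuclideanSpace.single i (1 : ℝ)) b₀| ≤
        C * Real.exp (-(δ * torusSupNorm (Mk (⟨d + 1, L, m, K, hd, hL⟩ : Params) j) (rep (Mk (⟨d + 1, L, m, K, hd, hL⟩ : Params) j) (iterBlockOf j b₀.src) - rep (Mk (⟨d + 1, L, m, K, hd, hL⟩ : Params) j) y))) := by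
  obtain ⟨δ₂, hδ₂, C₂, hC₂, hDG⟩ := blockBound_DG_scaling d L hd hL ha₀ ha₁
  obtain ⟨δ₄, hδ₄, C₄, hC₄, hQR⟩ := blockBound_QsRinv_scaling d L hd hL ha₀ ha₁
  have hδH4 : min (δ₂ / 2) δ₄ ≤ δ₄ := min_le_right _ _
  have hδH2 : min (δ₂ / 2) δ₄ < δ₂ := (min_le_left _ _).trans_lt (half_lt_self hδ₂)
  have hKH : 0 ≤ latticeConst (d + 1) (δ₂ - min (δ₂ / 2) δ₄) := latticeConst_nonneg _ (by linarith)
  refine ⟨min (δ₂ / 2) δ₄, lt_min (half_pos hδ₂) hδ₄, C₂ * C₄ * latticeConst (d + 1) (δ₂ - min (δ₂ / 2) δ₄), by positivity,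
    fun m K j hc hj Λ' w hw0 hw1 lam b₀ y => ?_⟩
  rw [comp_Hts_eq]
  exact blockBound_comp (KY := fun a => latticeConst (d + 1) a) (torusDist_isPseudoDist (Mk (⟨d + 1, L, m, K, hd, hL⟩ : Params) j)) (torusDist_sumBound (Mk (⟨d + 1, L, m, K, hd, hL⟩ : Params) j))
    (((((L : ℝ) ^ j) • (onE (LinearMap.funLeft ℝ ℝ (fun b : PBond (⟨d + 1, L, m, K, hd, hL⟩ : Params) 0 =>
        (⟨b.src.shift lam, b.dir⟩ : PBond (⟨d + 1, L, m, K, hd, hL⟩ : Params) 0))) - LinearMap.id) :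
      BondSpace (⟨d + 1, L, m, K, hd, hL⟩ : Params) →ₗ[ℝ] BondSpace (⟨d + 1, L, m, K, hd, hL⟩ : Params))) ∘ₗ (tsV1 hc Λ' w).G)
    (LinearMap.adjoint (tsV1 hc Λ' w).Q ∘ₗ Ring.inverse (QGQs hc Λ' (w := w)))
    (fun b₀ : PBond (⟨d + 1, L, m, K, hd, hL⟩ : Params) 0 => iterBlockOf j b₀.src)
    (fun b₀ : PBond (⟨d + 1, L, m, K, hd, hL⟩ : Params) 0 => iterBlockOf j b₀.src) (Sum.elim (fun o : OutBond j Λ' => o.1.src)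
          (fun b₁ : InBond j Λ' => Site.blockSite b₁.1.src (fun _ => ⟨0, Params.L_pos _⟩)) :
            CIdx j Λ' → Site (⟨d + 1, L, m, K, hd, hL⟩ : Params) j)
    hC₂ hC₄ (lt_min (half_pos hδ₂) hδ₄).le hδH4 hδH2 (hDG m K j hc hj Λ' w hw0 hw1 lam) (hQR m K j hc hj Λ' w hw0 hw1) b₀ y

open Classical in
/-- **COROLLARY 2.8, (2.151)₂ IN THE PRINTED SHAPE**: there are `δ₅ > 0`, `C ≥ 0` depending on `d, L, a₀, a₁` only such that for every volume,
`j + 1 ≤ m + K`, `Λ′`, weights of the window, direction `λ`, radius `r ≥ 0`, every `B ∈ L²(𝔅)` supported on the indices sited within `r` of `y′` with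
`|B| ≤ X`, and every fine bond `b₀` over the unit sites within `r` of `y`: `|n·((HB)(b₀ + e_λ) − (HB)(b₀))| ≤ C·e^{(1+2δ₅)r}·e^{−δ₅|y − y′|_T}·X` —
print's *«|(∇H)(b,c)| ≦ O(1)(L^jη)^{−1}(L^{j′}η)^{−d}e^{−δ₅d(y,c₋)}»* (the `(L^jη)^{−1}` converts print's `η`-lattice difference quotient into our
`ξ`-lattice one). [cite: Balaban1984PropagatorsII, Cor. 2.8 (2.150)–(2.151) p.249] -/
theorem cor28_ineq2151_DH (d L : ℕ) (hd : 1 ≤ d + 1) (hL : Odd L ∧ 1 < L) {a₀ a₁ : ℝ} (ha₀ : 0 < a₀) (ha₁ : a₀ ≤ a₁) :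
    ∃ δ : ℝ, 0 < δ ∧ ∃ C : ℝ, 0 ≤ C ∧ ∀ (m K : ℕ) (j : ℕ) (hc : ((L : ℝ) ^ j) ≠ 0)
      (_hj : j + 1 ≤ (⟨d + 1, L, m, K, hd, hL⟩ : Params).m + (⟨d + 1, L, m, K, hd, hL⟩ : Params).K)
      (Λ' : Finset (Site (⟨d + 1, L, m, K, hd, hL⟩ : Params) (j + 1))) (w : CIdx j Λ' → ℝ)
      (_hw0 : ∀ i, a₀ * ((L : ℝ) ^ j) ^ (d + 1) ≤ w i) (_hw1 : ∀ i, w i ≤ a₁ * ((L : ℝ) ^ j) ^ (d + 1)) (lam : Fin (d + 1))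
      (r : ℝ) (_hr : 0 ≤ r) (B : CSpace j Λ') (X : ℝ) (_hX : 0 ≤ X) (y y' : Site (⟨d + 1, L, m, K, hd, hL⟩ : Params) j)
      (_hsupp : ∀ i : CIdx j Λ', B i ≠ 0 → torusSupNorm (Mk (⟨d + 1, L, m, K, hd, hL⟩ : Params) j) (rep (Mk (⟨d + 1, L, m, K, hd, hL⟩ : Params) j) ((Sum.elim (fun o : OutBond j Λ' => o.1.src)
            (fun b₁ : InBond j Λ' => Site.blockSite b₁.1.src (fun _ => ⟨0, Params.L_pos _⟩)) :
              CIdx j Λ' → Site (⟨d + 1, L, m, K, hd, hL⟩ : Params) j) i) - rep (Mk (⟨d + 1, L, m, K, hd, hL⟩ : Params) j) y') ≤ r) (_hB : ∀ i : CIdx j Λ', |B i| ≤ X)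
      (b₀ : PBond (⟨d + 1, L, m, K, hd, hL⟩ : Params) 0) (_hb₀ : torusSupNorm (Mk (⟨d + 1, L, m, K, hd, hL⟩ : Params) j) (rep (Mk (⟨d + 1, L, m, K, hd, hL⟩ : Params) j) (iterBlockOf j b₀.src) - rep (Mk (⟨d + 1, L, m, K, hd, hL⟩ : Params) j) y) ≤ r),
      |((L : ℝ) ^ j) * (Hts hc Λ' (w := w) B ⟨b₀.src.shift lam, b₀.dir⟩ - Hts hc Λ' (w := w) B b₀)| ≤
        C * Real.exp ((1 + 2 * δ) * r) * Real.exp (-(δ * torusSupNorm (Mk (⟨d + 1, L, m, K, hd, hL⟩ : Params) j) (rep (Mk (⟨d + 1, L, m, K, hd, hL⟩ : Params) j) y - rep (Mk (⟨d + 1, L, m, K, hd, hL⟩ : Params) j) y'))) * X := by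
  obtain ⟨δ, hδ, C, hC, h⟩ := blockBound_DHts_scaling d L hd hL ha₀ ha₁
  refine ⟨δ, hδ, C * latticeConst (d + 1) 1, mul_nonneg hC (latticeConst_nonneg _ zero_le_one), ?_⟩
  intro m K j hc hj Λ' w hw0 hw1 lam r hr B X hX y y' hsupp hB b₀ hb₀
  have h' := abs_apply_le_of_support (KY := fun a => latticeConst (d + 1) a) (torusDist_isPseudoDist (Mk (⟨d + 1, L, m, K, hd, hL⟩ : Params) j)) (torusDist_sumBound (Mk (⟨d + 1, L, m, K, hd, hL⟩ : Params) j))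
    (((((L : ℝ) ^ j) • (onE (LinearMap.funLeft ℝ ℝ (fun b : PBond (⟨d + 1, L, m, K, hd, hL⟩ : Params) 0 =>
        (⟨b.src.shift lam, b.dir⟩ : PBond (⟨d + 1, L, m, K, hd, hL⟩ : Params) 0))) - LinearMap.id) :
      BondSpace (⟨d + 1, L, m, K, hd, hL⟩ : Params) →ₗ[ℝ] BondSpace (⟨d + 1, L, m, K, hd, hL⟩ : Params))) ∘ₗ Hts hc Λ' (w := w))
    (fun b₀ : PBond (⟨d + 1, L, m, K, hd, hL⟩ : Params) 0 => iterBlockOf j b₀.src) (Sum.elim (fun o : OutBond j Λ' => o.1.src)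
          (fun b₁ : InBond j Λ' => Site.blockSite b₁.1.src (fun _ => ⟨0, Params.L_pos _⟩)) :
            CIdx j Λ' → Site (⟨d + 1, L, m, K, hd, hL⟩ : Params) j) hC hδ.le hX
    (h m K j hc hj Λ' w hw0 hw1 lam) B y y' hsupp hB b₀ hb₀
  rw [Dop_comp_apply] at h'
  refine h'.trans (le_of_eq ?_)
  ring

/-! ## §6  Corollary 2.8, the member `‖(ζ∇H)(·, c)‖_α`: the pair (Hölder) bound of `D_λH` and the printed shape -/

open Classical in
/-- **COROLLARY 2.8, THE HÖLDER CONTINUITY OF `∇H` AS A PAIR BOUND**: there is `δ₅ > 0` depending on `d, L, a₀, a₁` only and for every `0 ≤ α < 1`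
a `C_α ≥ 0` (the rate `δ₅` NOT depending on `α`, as printed) such that for every volume, `j + 1 ≤ m + K`, `Λ′`, weights of the window, direction `λ`,
fine bonds `b₁ = ⟨x, ν⟩`, `b₂ = ⟨x′, ν⟩` with `|x − x′|_∞ ≤ n` (`t = |x − x′|_∞/n ≤ 1`) and unit site `y`:
`Σ_{c ∈ 𝔅 : site(c) = y}|(D_λH)(e_c)_{b₁} − (D_λH)(e_c)_{b₂}| ≤ C_α·t^α·e^{−δ₅|y(x) − y|_T}` — r03's `α`-free pair bound of `D_λG`
(`…B6Prop25HolderRateFreeV1.holderBound_DG_rateFree`, the rate-free twin of p38's `holderBound_DG_scaling`) composed with §3's block bound of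
`Q*(QGQ*)⁻¹` (p38's `holderBound_comp`: Hölder norm of the first factor times the block bound of the second, no volume factor).
[cite: Balaban1984PropagatorsII, Cor. 2.8 (2.151) p.249; Balaban1984PropagatorsI, (1.109), (1.111) p.35] -/
theorem holderBound_DHts_scaling (d L : ℕ) (hd : 1 ≤ d + 1) (hL : Odd L ∧ 1 < L) {a₀ a₁ : ℝ} (ha₀ : 0 < a₀) (ha₁ : a₀ ≤ a₁) :
    ∃ δ : ℝ, 0 < δ ∧ ∀ α : ℝ, 0 ≤ α → α < 1 → ∃ C : ℝ, 0 ≤ C ∧ ∀ (m K : ℕ) (j : ℕ) (hc : ((L : ℝ) ^ j) ≠ 0)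
      (_hj : j + 1 ≤ (⟨d + 1, L, m, K, hd, hL⟩ : Params).m + (⟨d + 1, L, m, K, hd, hL⟩ : Params).K)
      (Λ' : Finset (Site (⟨d + 1, L, m, K, hd, hL⟩ : Params) (j + 1))) (w : CIdx j Λ' → ℝ)
      (_hw0 : ∀ i, a₀ * ((L : ℝ) ^ j) ^ (d + 1) ≤ w i) (_hw1 : ∀ i, w i ≤ a₁ * ((L : ℝ) ^ j) ^ (d + 1)) (lam : Fin (d + 1))
      (b₁ b₂ : PBond (⟨d + 1, L, m, K, hd, hL⟩ : Params) 0) (_hdir : b₁.dir = b₂.dir) (_hle : supDist b₁.src b₂.src ≤ L ^ j)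
      (y : Site (⟨d + 1, L, m, K, hd, hL⟩ : Params) j),
      ∑ i ∈ univ.filter (fun i : CIdx j Λ' => (Sum.elim (fun o : OutBond j Λ' => o.1.src)
            (fun b₁ : InBond j Λ' => Site.blockSite b₁.1.src (fun _ => ⟨0, Params.L_pos _⟩)) :
              CIdx j Λ' → Site (⟨d + 1, L, m, K, hd, hL⟩ : Params) j) i = y),
          |(((((L : ℝ) ^ j) • (onE (LinearMap.funLeft ℝ ℝ (fun b : PBond (⟨d + 1, L, m, K, hd, hL⟩ : Params) 0 =>
              (⟨b.src.shift lam, b.dir⟩ : PBond (⟨d + 1, L, m, K, hd, hL⟩ : Params) 0))) - LinearMap.id) :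
            BondSpace (⟨d + 1, L, m, K, hd, hL⟩ : Params) →ₗ[ℝ] BondSpace (⟨d + 1, L, m, K, hd, hL⟩ : Params))) ∘ₗ Hts hc Λ' (w := w))
            (EuclideanSpace.single i (1 : ℝ)) b₁ -
           (((((L : ℝ) ^ j) • (onE (LinearMap.funLeft ℝ ℝ (fun b : PBond (⟨d + 1, L, m, K, hd, hL⟩ : Params) 0 =>
              (⟨b.src.shift lam, b.dir⟩ : PBond (⟨d + 1, L, m, K, hd, hL⟩ : Params) 0))) - LinearMap.id) :
            BondSpace (⟨d + 1, L, m, K, hd, hL⟩ : Params) →ₗ[ℝ] BondSpace (⟨d + 1, L, m, K, hd, hL⟩ : Params))) ∘ₗ Hts hc Λ' (w := w))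
            (EuclideanSpace.single i (1 : ℝ)) b₂| ≤
        C * (((supDist b₁.src b₂.src : ℕ) : ℝ) / (L : ℝ) ^ j) ^ α *
          Real.exp (-(δ * torusSupNorm (Mk (⟨d + 1, L, m, K, hd, hL⟩ : Params) j) (rep (Mk (⟨d + 1, L, m, K, hd, hL⟩ : Params) j) (iterBlockOf j b₁.src) - rep (Mk (⟨d + 1, L, m, K, hd, hL⟩ : Params) j) y))) := by
  obtain ⟨δ₂, hδ₂, HH⟩ := holderBound_DG_rateFree d L hd hL ha₀ ha₁
  obtain ⟨δ₄, hδ₄, C₄, hC₄, hQR⟩ := blockBound_QsRinv_scaling d L hd hL ha₀ ha₁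
  have hδH4 : min (δ₂ / 2) δ₄ ≤ δ₄ := min_le_right _ _
  have hδH2 : min (δ₂ / 2) δ₄ < δ₂ := (min_le_left _ _).trans_lt (half_lt_self hδ₂)
  have hK : 0 ≤ latticeConst (d + 1) (δ₂ - min (δ₂ / 2) δ₄) := latticeConst_nonneg _ (by linarith)
  refine ⟨min (δ₂ / 2) δ₄, lt_min (half_pos hδ₂) hδ₄, fun α hα0 hα1 => ?_⟩
  obtain ⟨CH, hCH, hH⟩ := HH α hα0 hα1
  refine ⟨CH * C₄ * latticeConst (d + 1) (δ₂ - min (δ₂ / 2) δ₄), by positivity, ?_⟩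
  intro m K j hc hj Λ' w hw0 hw1 lam b₁ b₂ hdir hle y
  have hL0 : (0 : ℝ) < L := by exact_mod_cast (lt_trans Nat.zero_lt_one hL.2)
  have ht0 : 0 ≤ (((supDist b₁.src b₂.src : ℕ) : ℝ) / (L : ℝ) ^ j) ^ α := Real.rpow_nonneg (by positivity) _
  rw [comp_Hts_eq]
  have h := holderBound_comp (KY := fun a => latticeConst (d + 1) a) (torusDist_isPseudoDist (Mk (⟨d + 1, L, m, K, hd, hL⟩ : Params) j)) (torusDist_sumBound (Mk (⟨d + 1, L, m, K, hd, hL⟩ : Params) j))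
    (((((L : ℝ) ^ j) • (onE (LinearMap.funLeft ℝ ℝ (fun b : PBond (⟨d + 1, L, m, K, hd, hL⟩ : Params) 0 =>
        (⟨b.src.shift lam, b.dir⟩ : PBond (⟨d + 1, L, m, K, hd, hL⟩ : Params) 0))) - LinearMap.id) :
      BondSpace (⟨d + 1, L, m, K, hd, hL⟩ : Params) →ₗ[ℝ] BondSpace (⟨d + 1, L, m, K, hd, hL⟩ : Params))) ∘ₗ (tsV1 hc Λ' w).G)
    (LinearMap.adjoint (tsV1 hc Λ' w).Q ∘ₗ Ring.inverse (QGQs hc Λ' (w := w)))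
    (fun b₀ : PBond (⟨d + 1, L, m, K, hd, hL⟩ : Params) 0 => iterBlockOf j b₀.src) (Sum.elim (fun o : OutBond j Λ' => o.1.src)
          (fun b₁ : InBond j Λ' => Site.blockSite b₁.1.src (fun _ => ⟨0, Params.L_pos _⟩)) :
            CIdx j Λ' → Site (⟨d + 1, L, m, K, hd, hL⟩ : Params) j) b₁ b₂ (iterBlockOf j b₁.src)
    (Cf := CH * (((supDist b₁.src b₂.src : ℕ) : ℝ) / (L : ℝ) ^ j) ^ α) (Cg := C₄) (a := δ₂) (b := δ₄) (δ' := min (δ₂ / 2) δ₄)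
    (by positivity) hC₄ (lt_min (half_pos hδ₂) hδ₄).le hδH4 hδH2 (hH m K j hc hj Λ' w hw0 hw1 lam b₁ b₂ hdir hle)
    (hQR m K j hc hj Λ' w hw0 hw1) y
  refine h.trans (le_of_eq ?_)
  ring

open Classical in
/-- **COROLLARY 2.8, (2.151)₃ IN THE PRINTED SHAPE** (the Hölder member, as p38's `prop25_ineq111_grad` for `G`): there is `δ₅ > 0` depending on
`d, L, a₀, a₁` only and for every `0 ≤ α < 1` a `C_α ≥ 0` such that for every volume, `j + 1 ≤ m + K`, `Λ′`, weights of the window, direction `λ`,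
radius `r ≥ 0`, every `B ∈ L²(𝔅)` supported on the indices sited within `r` of `y′` with `|B| ≤ X`, every cut-off `ζ` on the fine sites supported
over the unit sites within `r` of `y` with `|ζ| ≤ Z₀`, and every pair of fine bonds `b₁ = ⟨x, ν⟩`, `b₂ = ⟨x′, ν⟩` with `|x − x′|_∞ ≤ n`
(`t = |x − x′|_∞/n`) and `|ζ(x) − ζ(x′)| ≤ Z_h·t^α`:
`|ζ(x)·n((HB)(b₁ + e_λ) − (HB)(b₁)) − ζ(x′)·n((HB)(b₂ + e_λ) − (HB)(b₂))| ≤ C_α·e^{(1+2δ₅)(r+1)}·e^{−δ₅|y − y′|_T}·(Z_h + Z₀)·X·t^α` (ONE `δ₅` for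
all `α`) —
print's *«‖(ζ∇H)(·,c)‖_α ≦ O(1)(L^jη)^{−1−α}(‖ζ‖^ξ_α + |ζ|)(L^{j′}η)^{−d}e^{−δ₅d(y,c₋)}, supp ζ ⊂ Δ(y)»* (the `α`-Hölder quotient of `ζ∇_λHB` at
scale `≤ 1`; §5 for the sup part, the pair bound above for the difference, p38's `abs_cutoff_pairDiff_le`).
[cite: Balaban1984PropagatorsII, Cor. 2.8 (2.150)–(2.151) p.249; Balaban1984PropagatorsI, (1.109), (1.111) p.35] -/
theorem cor28_ineq2151_holder (d L : ℕ) (hd : 1 ≤ d + 1) (hL : Odd L ∧ 1 < L) {a₀ a₁ : ℝ} (ha₀ : 0 < a₀) (ha₁ : a₀ ≤ a₁) :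
    ∃ δ : ℝ, 0 < δ ∧ ∀ α : ℝ, 0 ≤ α → α < 1 → ∃ C : ℝ, 0 ≤ C ∧ ∀ (m K : ℕ) (j : ℕ) (hc : ((L : ℝ) ^ j) ≠ 0)
      (_hj : j + 1 ≤ (⟨d + 1, L, m, K, hd, hL⟩ : Params).m + (⟨d + 1, L, m, K, hd, hL⟩ : Params).K)
      (Λ' : Finset (Site (⟨d + 1, L, m, K, hd, hL⟩ : Params) (j + 1))) (w : CIdx j Λ' → ℝ)
      (_hw0 : ∀ i, a₀ * ((L : ℝ) ^ j) ^ (d + 1) ≤ w i) (_hw1 : ∀ i, w i ≤ a₁ * ((L : ℝ) ^ j) ^ (d + 1)) (lam : Fin (d + 1))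
      (r : ℝ) (_hr : 0 ≤ r) (B : CSpace j Λ') (X : ℝ) (_hX : 0 ≤ X) (y y' : Site (⟨d + 1, L, m, K, hd, hL⟩ : Params) j)
      (_hsupp : ∀ i : CIdx j Λ', B i ≠ 0 → torusSupNorm (Mk (⟨d + 1, L, m, K, hd, hL⟩ : Params) j) (rep (Mk (⟨d + 1, L, m, K, hd, hL⟩ : Params) j) ((Sum.elim (fun o : OutBond j Λ' => o.1.src)
            (fun b₁ : InBond j Λ' => Site.blockSite b₁.1.src (fun _ => ⟨0, Params.L_pos _⟩)) :
              CIdx j Λ' → Site (⟨d + 1, L, m, K, hd, hL⟩ : Params) j) i) - rep (Mk (⟨d + 1, L, m, K, hd, hL⟩ : Params) j) y') ≤ r) (_hB : ∀ i : CIdx j Λ', |B i| ≤ X)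
      (ζ : Site (⟨d + 1, L, m, K, hd, hL⟩ : Params) 0 → ℝ) (Zh Z0 : ℝ) (_hZh : 0 ≤ Zh) (_hZ0 : 0 ≤ Z0)
      (_hζs : ∀ x : Site (⟨d + 1, L, m, K, hd, hL⟩ : Params) 0, ζ x ≠ 0 → torusSupNorm (Mk (⟨d + 1, L, m, K, hd, hL⟩ : Params) j) (rep (Mk (⟨d + 1, L, m, K, hd, hL⟩ : Params) j) (iterBlockOf j x) - rep (Mk (⟨d + 1, L, m, K, hd, hL⟩ : Params) j) y) ≤ r)
      (_hζ0 : ∀ x : Site (⟨d + 1, L, m, K, hd, hL⟩ : Params) 0, |ζ x| ≤ Z0)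
      (b₁ b₂ : PBond (⟨d + 1, L, m, K, hd, hL⟩ : Params) 0) (_hdir : b₁.dir = b₂.dir) (_hle : supDist b₁.src b₂.src ≤ L ^ j)
      (_hζh : |ζ b₁.src - ζ b₂.src| ≤ Zh * (((supDist b₁.src b₂.src : ℕ) : ℝ) / (L : ℝ) ^ j) ^ α),
      |ζ b₁.src * (((L : ℝ) ^ j) * (Hts hc Λ' (w := w) B ⟨b₁.src.shift lam, b₁.dir⟩ - Hts hc Λ' (w := w) B b₁)) -
        ζ b₂.src * (((L : ℝ) ^ j) * (Hts hc Λ' (w := w) B ⟨b₂.src.shift lam, b₂.dir⟩ - Hts hc Λ' (w := w) B b₂))| ≤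
        C * Real.exp ((1 + 2 * δ) * (r + 1)) * Real.exp (-(δ * torusSupNorm (Mk (⟨d + 1, L, m, K, hd, hL⟩ : Params) j) (rep (Mk (⟨d + 1, L, m, K, hd, hL⟩ : Params) j) y - rep (Mk (⟨d + 1, L, m, K, hd, hL⟩ : Params) j) y'))) *
          (Zh + Z0) * X * (((supDist b₁.src b₂.src : ℕ) : ℝ) / (L : ℝ) ^ j) ^ α := by
  obtain ⟨δS, hδS, CS, hCS, hS⟩ := blockBound_DHts_scaling d L hd hL ha₀ ha₁
  obtain ⟨δH, hδH, HH⟩ := holderBound_DHts_scaling d L hd hL ha₀ ha₁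
  refine ⟨min δS δH, lt_min hδS hδH, fun α hα0 hα1 => ?_⟩
  obtain ⟨CH, hCH, hH⟩ := HH α hα0 hα1
  have hK10 : 0 ≤ latticeConst (d + 1) 1 := latticeConst_nonneg _ zero_le_one
  refine ⟨(CS + CH) * latticeConst (d + 1) 1, by positivity, ?_⟩
  intro m K j hc hj Λ' w hw0 hw1 lam r hr B X hX y y' hsupp hB ζ Zh Z0 hZh hZ0 hζs hζ0 b₁ b₂ hdir hle hζh
  have hj' : j ≤ m + K := Nat.le_of_succ_le hj
  have hL0 : 0 < L := by have := hL.2; omega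
  have hLp : (0 : ℝ) < L := by exact_mod_cast hL0
  set δ' : ℝ := min δS δH with hδ'
  have hδ'0 : 0 ≤ δ' := le_min hδS.le hδH.le
  have hδ'S : δ' ≤ δS := min_le_left _ _
  have hδ'H : δ' ≤ δH := min_le_right _ _
  have ht0 : 0 ≤ (((supDist b₁.src b₂.src : ℕ) : ℝ) / (L : ℝ) ^ j) := by positivity
  have htα0 : 0 ≤ (((supDist b₁.src b₂.src : ℕ) : ℝ) / (L : ℝ) ^ j) ^ α := Real.rpow_nonneg ht0 _
  have hρ : IsPseudoDist (fun t t' : Site (⟨d + 1, L, m, K, hd, hL⟩ : Params) j => torusSupNorm (Mk (⟨d + 1, L, m, K, hd, hL⟩ : Params) j) (rep (Mk (⟨d + 1, L, m, K, hd, hL⟩ : Params) j) t - rep (Mk (⟨d + 1, L, m, K, hd, hL⟩ : Params) j) t')) :=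
    torusDist_isPseudoDist (Mk (⟨d + 1, L, m, K, hd, hL⟩ : Params) j)
  -- the trivial case: both values of the cut-off vanish
  by_cases hz : ζ b₁.src = 0 ∧ ζ b₂.src = 0
  · rw [hz.1, hz.2, zero_mul, zero_mul, sub_zero, abs_zero]
    positivity
  -- otherwise the anchor `y(x)` is within `r + 1` of `y` (`|y(x) − y(x′)|_T ≤ 1`)
  have hz1 : torusSupNorm (Mk (⟨d + 1, L, m, K, hd, hL⟩ : Params) j) (rep (Mk (⟨d + 1, L, m, K, hd, hL⟩ : Params) j) (iterBlockOf j b₁.src) - rep (Mk (⟨d + 1, L, m, K, hd, hL⟩ : Params) j) y) ≤ r + 1 := by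
    rw [not_and_or] at hz
    rcases hz with h1 | h2
    · exact (hζs _ h1).trans (by linarith)
    · have h12 : torusSupNorm (Mk (⟨d + 1, L, m, K, hd, hL⟩ : Params) j) (rep (Mk (⟨d + 1, L, m, K, hd, hL⟩ : Params) j) (iterBlockOf j b₁.src) - rep (Mk (⟨d + 1, L, m, K, hd, hL⟩ : Params) j) (iterBlockOf j b₂.src)) ≤ 1 := by
        rw [← supDist_cast_eq_torusSupNorm]
        exact_mod_cast supDist_blk_le_one hj' b₁.src b₂.src hle
      calc torusSupNorm (Mk (⟨d + 1, L, m, K, hd, hL⟩ : Params) j) (rep (Mk (⟨d + 1, L, m, K, hd, hL⟩ : Params) j) (iterBlockOf j b₁.src) - rep (Mk (⟨d + 1, L, m, K, hd, hL⟩ : Params) j) y)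
          ≤ torusSupNorm (Mk (⟨d + 1, L, m, K, hd, hL⟩ : Params) j) (rep (Mk (⟨d + 1, L, m, K, hd, hL⟩ : Params) j) (iterBlockOf j b₁.src) - rep (Mk (⟨d + 1, L, m, K, hd, hL⟩ : Params) j) (iterBlockOf j b₂.src)) +
            torusSupNorm (Mk (⟨d + 1, L, m, K, hd, hL⟩ : Params) j) (rep (Mk (⟨d + 1, L, m, K, hd, hL⟩ : Params) j) (iterBlockOf j b₂.src) - rep (Mk (⟨d + 1, L, m, K, hd, hL⟩ : Params) j) y) := hρ.triangle _ _ _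
        _ ≤ 1 + r := add_le_add h12 (hζs _ h2)
        _ = r + 1 := add_comm _ _
  -- the sup part `|n((HB)(b₁ + e_λ) − (HB)(b₁))|` at the rate `δ'` (§5)
  have bS := blockBound_mono hρ (((((L : ℝ) ^ j) • (onE (LinearMap.funLeft ℝ ℝ (fun b : PBond (⟨d + 1, L, m, K, hd, hL⟩ : Params) 0 =>
        (⟨b.src.shift lam, b.dir⟩ : PBond (⟨d + 1, L, m, K, hd, hL⟩ : Params) 0))) - LinearMap.id) :
      BondSpace (⟨d + 1, L, m, K, hd, hL⟩ : Params) →ₗ[ℝ] BondSpace (⟨d + 1, L, m, K, hd, hL⟩ : Params))) ∘ₗ Hts hc Λ' (w := w))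
    (fun b₀ : PBond (⟨d + 1, L, m, K, hd, hL⟩ : Params) 0 => iterBlockOf j b₀.src) (Sum.elim (fun o : OutBond j Λ' => o.1.src)
          (fun b₁ : InBond j Λ' => Site.blockSite b₁.1.src (fun _ => ⟨0, Params.L_pos _⟩)) :
            CIdx j Λ' → Site (⟨d + 1, L, m, K, hd, hL⟩ : Params) j) hCS le_rfl hδ'S (hS m K j hc hj Λ' w hw0 hw1 lam)
  have hSx := abs_apply_le_of_support (KY := fun a => latticeConst (d + 1) a) hρ (torusDist_sumBound (Mk (⟨d + 1, L, m, K, hd, hL⟩ : Params) j))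
    (((((L : ℝ) ^ j) • (onE (LinearMap.funLeft ℝ ℝ (fun b : PBond (⟨d + 1, L, m, K, hd, hL⟩ : Params) 0 =>
        (⟨b.src.shift lam, b.dir⟩ : PBond (⟨d + 1, L, m, K, hd, hL⟩ : Params) 0))) - LinearMap.id) :
      BondSpace (⟨d + 1, L, m, K, hd, hL⟩ : Params) →ₗ[ℝ] BondSpace (⟨d + 1, L, m, K, hd, hL⟩ : Params))) ∘ₗ Hts hc Λ' (w := w))
    (fun b₀ : PBond (⟨d + 1, L, m, K, hd, hL⟩ : Params) 0 => iterBlockOf j b₀.src) (Sum.elim (fun o : OutBond j Λ' => o.1.src)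
          (fun b₁ : InBond j Λ' => Site.blockSite b₁.1.src (fun _ => ⟨0, Params.L_pos _⟩)) :
            CIdx j Λ' → Site (⟨d + 1, L, m, K, hd, hL⟩ : Params) j) hCS hδ'0 hX bS B y y'
    (fun k hk => (hsupp k hk).trans (by linarith)) hB b₁ hz1
  rw [Dop_comp_apply] at hSx
  -- the pair part at the rate `δ'` (§6)
  have pH := holderBound_mono hρ (((((L : ℝ) ^ j) • (onE (LinearMap.funLeft ℝ ℝ (fun b : PBond (⟨d + 1, L, m, K, hd, hL⟩ : Params) 0 =>
        (⟨b.src.shift lam, b.dir⟩ : PBond (⟨d + 1, L, m, K, hd, hL⟩ : Params) 0))) - LinearMap.id) :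
      BondSpace (⟨d + 1, L, m, K, hd, hL⟩ : Params) →ₗ[ℝ] BondSpace (⟨d + 1, L, m, K, hd, hL⟩ : Params))) ∘ₗ Hts hc Λ' (w := w))
    (Sum.elim (fun o : OutBond j Λ' => o.1.src)
          (fun b₁ : InBond j Λ' => Site.blockSite b₁.1.src (fun _ => ⟨0, Params.L_pos _⟩)) :
            CIdx j Λ' → Site (⟨d + 1, L, m, K, hd, hL⟩ : Params) j) b₁ b₂ (iterBlockOf j b₁.src)
    (C' := CH * (((supDist b₁.src b₂.src : ℕ) : ℝ) / (L : ℝ) ^ j) ^ α) (by positivity) le_rfl hδ'H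
    (hH m K j hc hj Λ' w hw0 hw1 lam b₁ b₂ hdir hle)
  have hHx := pairDiff_le_of_support (KY := fun a => latticeConst (d + 1) a) hρ (torusDist_sumBound (Mk (⟨d + 1, L, m, K, hd, hL⟩ : Params) j))
    (((((L : ℝ) ^ j) • (onE (LinearMap.funLeft ℝ ℝ (fun b : PBond (⟨d + 1, L, m, K, hd, hL⟩ : Params) 0 =>
        (⟨b.src.shift lam, b.dir⟩ : PBond (⟨d + 1, L, m, K, hd, hL⟩ : Params) 0))) - LinearMap.id) :
      BondSpace (⟨d + 1, L, m, K, hd, hL⟩ : Params) →ₗ[ℝ] BondSpace (⟨d + 1, L, m, K, hd, hL⟩ : Params))) ∘ₗ Hts hc Λ' (w := w))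
    (Sum.elim (fun o : OutBond j Λ' => o.1.src)
          (fun b₁ : InBond j Λ' => Site.blockSite b₁.1.src (fun _ => ⟨0, Params.L_pos _⟩)) :
            CIdx j Λ' → Site (⟨d + 1, L, m, K, hd, hL⟩ : Params) j) b₁ b₂ (iterBlockOf j b₁.src) (by positivity) hδ'0 hX pH B y y' (fun k hk => (hsupp k hk).trans (by linarith)) hB hz1
  rw [Dop_comp_apply, Dop_comp_apply] at hHx
  -- the cut-off product rule
  refine (abs_cutoff_pairDiff_le hSx hHx hζh (hζ0 b₂.src)).trans ?_
  have hE0 : 0 ≤ (((supDist b₁.src b₂.src : ℕ) : ℝ) / (L : ℝ) ^ j) ^ α * (latticeConst (d + 1) 1 * Real.exp ((1 + 2 * δ') * (r + 1)) *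
      Real.exp (-(δ' * torusSupNorm (Mk (⟨d + 1, L, m, K, hd, hL⟩ : Params) j) (rep (Mk (⟨d + 1, L, m, K, hd, hL⟩ : Params) j) y - rep (Mk (⟨d + 1, L, m, K, hd, hL⟩ : Params) j) y')))) * X := by positivity
  have hcoef : Zh * CS + Z0 * CH ≤ (CS + CH) * (Zh + Z0) := by nlinarith [mul_nonneg hCS hZ0, mul_nonneg hCH hZh]
  calc Zh * (((supDist b₁.src b₂.src : ℕ) : ℝ) / (L : ℝ) ^ j) ^ α * (CS * (latticeConst (d + 1) 1 * Real.exp ((1 + 2 * δ') * (r + 1))) *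
          Real.exp (-(δ' * torusSupNorm (Mk (⟨d + 1, L, m, K, hd, hL⟩ : Params) j) (rep (Mk (⟨d + 1, L, m, K, hd, hL⟩ : Params) j) y - rep (Mk (⟨d + 1, L, m, K, hd, hL⟩ : Params) j) y'))) * X) +
        Z0 * (CH * (((supDist b₁.src b₂.src : ℕ) : ℝ) / (L : ℝ) ^ j) ^ α * (latticeConst (d + 1) 1 * Real.exp ((1 + 2 * δ') * (r + 1))) *
          Real.exp (-(δ' * torusSupNorm (Mk (⟨d + 1, L, m, K, hd, hL⟩ : Params) j) (rep (Mk (⟨d + 1, L, m, K, hd, hL⟩ : Params) j) y - rep (Mk (⟨d + 1, L, m, K, hd, hL⟩ : Params) j) y'))) * X)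
        = (Zh * CS + Z0 * CH) * ((((supDist b₁.src b₂.src : ℕ) : ℝ) / (L : ℝ) ^ j) ^ α * (latticeConst (d + 1) 1 * Real.exp ((1 + 2 * δ') * (r + 1)) *
          Real.exp (-(δ' * torusSupNorm (Mk (⟨d + 1, L, m, K, hd, hL⟩ : Params) j) (rep (Mk (⟨d + 1, L, m, K, hd, hL⟩ : Params) j) y - rep (Mk (⟨d + 1, L, m, K, hd, hL⟩ : Params) j) y')))) * X) := by ring
    _ ≤ (CS + CH) * (Zh + Z0) * ((((supDist b₁.src b₂.src : ℕ) : ℝ) / (L : ℝ) ^ j) ^ α * (latticeConst (d + 1) 1 * Real.exp ((1 + 2 * δ') * (r + 1)) *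
          Real.exp (-(δ' * torusSupNorm (Mk (⟨d + 1, L, m, K, hd, hL⟩ : Params) j) (rep (Mk (⟨d + 1, L, m, K, hd, hL⟩ : Params) j) y - rep (Mk (⟨d + 1, L, m, K, hd, hL⟩ : Params) j) y')))) * X) :=
        mul_le_mul_of_nonneg_right hcoef hE0
    _ = _ := by ring

/-! ## §7  The same bounds for p21's `H` OF RECORD `hOp (GE) (QsE) (EE)` on the two-level family (printed weights), by reindexing -/

open Classical in
/-- **COROLLARY 2.8 FOR THE `H` OF RECORD** (p21's `hOp (GE D) (QsE D) (EE D)`, `D = twoScale j hj Λ′`, printed weights `a` on `Λ^c`, `aL^{d−1}` on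
`Λ′` inside the window): the block bound of §4 holds verbatim for the entries `hOp(e_p)(b₀)`, `p ∈ BondIdx D` sited through the reindexing
`𝔅 ≃ BondIdx D` — by gen 17's `…B6Eq235TwoScaleV1.hOp_single_apply` (the entries of the `H` of record ARE the entries of `Hts`).
[cite: Balaban1984PropagatorsII, (2.35) p.228, Cor. 2.8 (2.151) p.249] -/
theorem blockBound_hOp_scaling (d L : ℕ) (hd : 1 ≤ d + 1) (hL : Odd L ∧ 1 < L) {a₀ a₁ : ℝ} (ha₀ : 0 < a₀) (ha₁ : a₀ ≤ a₁) :
    ∃ δ : ℝ, 0 < δ ∧ ∃ C : ℝ, 0 ≤ C ∧ ∀ (m K : ℕ) (j : ℕ) (hc : ((L : ℝ) ^ j) ≠ 0)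
      (hj : j + 1 ≤ (⟨d + 1, L, m, K, hd, hL⟩ : Params).m + (⟨d + 1, L, m, K, hd, hL⟩ : Params).K)
      (Λ' : Finset (Site (⟨d + 1, L, m, K, hd, hL⟩ : Params) (j + 1))) (a : ℝ) (ha : 0 < a)
      (_hw0 : ∀ i, a₀ * ((L : ℝ) ^ j) ^ (d + 1) ≤ wPrinted (⟨d + 1, L, m, K, hd, hL⟩ : Params) j Λ' a i)
      (_hw1 : ∀ i, wPrinted (⟨d + 1, L, m, K, hd, hL⟩ : Params) j Λ' a i ≤ a₁ * ((L : ℝ) ^ j) ^ (d + 1))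
      (b₀ : PBond (⟨d + 1, L, m, K, hd, hL⟩ : Params) 0) (y : Site (⟨d + 1, L, m, K, hd, hL⟩ : Params) j),
      ∑ p ∈ univ.filter (fun p : BondIdx (twoScale j hj Λ') =>
          (Sum.elim (fun o : OutBond j Λ' => o.1.src)
                (fun b₁ : InBond j Λ' => Site.blockSite b₁.1.src (fun _ => ⟨0, Params.L_pos _⟩)) :
                  CIdx j Λ' → Site (⟨d + 1, L, m, K, hd, hL⟩ : Params) j) ((Equiv.ofBijective (toBondIdx hj Λ') (toBondIdx_bijective hj Λ')).symm p) = y),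
          |hOp (GE (twoScale j hj Λ') hc (w := wLevel (⟨d + 1, L, m, K, hd, hL⟩ : Params) j a) (wLevel_pos (j := j) ha))
            (QsE (twoScale j hj Λ')) (EE (twoScale j hj Λ') hc (w := wLevel (⟨d + 1, L, m, K, hd, hL⟩ : Params) j a) (wLevel_pos (j := j) ha))
            (EuclideanSpace.single p (1 : ℝ)) b₀| ≤
        C * Real.exp (-(δ * torusSupNorm (Mk (⟨d + 1, L, m, K, hd, hL⟩ : Params) j) (rep (Mk (⟨d + 1, L, m, K, hd, hL⟩ : Params) j) (iterBlockOf j b₀.src) - rep (Mk (⟨d + 1, L, m, K, hd, hL⟩ : Params) j) y))) := by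
  obtain ⟨δ, hδ, C, hC, h⟩ := blockBound_Hts_scaling d L hd hL ha₀ ha₁
  refine ⟨δ, hδ, C, hC, fun m K j hc hj Λ' a ha hw0 hw1 b₀ y => ?_⟩
  have h' := h m K j hc hj Λ' (wPrinted (⟨d + 1, L, m, K, hd, hL⟩ : Params) j Λ' a) hw0 hw1 b₀ y
  set e := Equiv.ofBijective (toBondIdx hj Λ') (toBondIdx_bijective hj Λ') with he
  rw [Finset.sum_filter] at h' ⊢
  calc ∑ p : BondIdx (twoScale j hj Λ'), (if (Sum.elim (fun o : OutBond j Λ' => o.1.src)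
        (fun b₁ : InBond j Λ' => Site.blockSite b₁.1.src (fun _ => ⟨0, Params.L_pos _⟩)) :
          CIdx j Λ' → Site (⟨d + 1, L, m, K, hd, hL⟩ : Params) j) (e.symm p) = y then
          |hOp (GE (twoScale j hj Λ') hc (w := wLevel (⟨d + 1, L, m, K, hd, hL⟩ : Params) j a) (wLevel_pos (j := j) ha))
            (QsE (twoScale j hj Λ')) (EE (twoScale j hj Λ') hc (w := wLevel (⟨d + 1, L, m, K, hd, hL⟩ : Params) j a) (wLevel_pos (j := j) ha))
            (EuclideanSpace.single p (1 : ℝ)) b₀| else 0)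
      = ∑ p : BondIdx (twoScale j hj Λ'), (if (Sum.elim (fun o : OutBond j Λ' => o.1.src)
            (fun b₁ : InBond j Λ' => Site.blockSite b₁.1.src (fun _ => ⟨0, Params.L_pos _⟩)) :
              CIdx j Λ' → Site (⟨d + 1, L, m, K, hd, hL⟩ : Params) j) (e.symm p) = y then
          |Hts hc Λ' (w := wPrinted (⟨d + 1, L, m, K, hd, hL⟩ : Params) j Λ' a) (EuclideanSpace.single (e.symm p) (1 : ℝ)) b₀| else 0) :=
        Finset.sum_congr rfl fun p _ => by rw [hOp_single_apply hc hj Λ' ha]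
    _ = ∑ i : CIdx j Λ', (if (Sum.elim (fun o : OutBond j Λ' => o.1.src)
          (fun b₁ : InBond j Λ' => Site.blockSite b₁.1.src (fun _ => ⟨0, Params.L_pos _⟩)) :
            CIdx j Λ' → Site (⟨d + 1, L, m, K, hd, hL⟩ : Params) j) i = y then
          |Hts hc Λ' (w := wPrinted (⟨d + 1, L, m, K, hd, hL⟩ : Params) j Λ' a) (EuclideanSpace.single i (1 : ℝ)) b₀| else 0) :=
        e.symm.sum_comp (fun i : CIdx j Λ' => if (Sum.elim (fun o : OutBond j Λ' => o.1.src)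
              (fun b₁ : InBond j Λ' => Site.blockSite b₁.1.src (fun _ => ⟨0, Params.L_pos _⟩)) :
                CIdx j Λ' → Site (⟨d + 1, L, m, K, hd, hL⟩ : Params) j) i = y then
          |Hts hc Λ' (w := wPrinted (⟨d + 1, L, m, K, hd, hL⟩ : Params) j Λ' a) (EuclideanSpace.single i (1 : ℝ)) b₀| else 0)
    _ ≤ _ := h'

open Classical in
/-- **(2.151)₁ IN THE PRINTED SHAPE FOR THE `H` OF RECORD**: for `B ∈ L²(BondIdx D)` supported on the indices sited (through the reindexing) within
`r` of `y′`, `|B| ≤ X`, and `b₀` over the unit sites within `r` of `y`: `|(hOp B)(b₀)| ≤ C·e^{(1+2δ₅)r}·e^{−δ₅|y − y′|_T}·X` (§4 through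
`…B6Eq235TwoScaleV1.hOp_eq`: `hOp = H ∘ reindex⁻¹`).  The members (2.151)₂,₃ transfer identically (`hOp B = H(reindex⁻¹B)`).
[cite: Balaban1984PropagatorsII, (2.35) p.228, Cor. 2.8 (2.150)–(2.151) p.249] -/
theorem cor28_ineq2151_hOp (d L : ℕ) (hd : 1 ≤ d + 1) (hL : Odd L ∧ 1 < L) {a₀ a₁ : ℝ} (ha₀ : 0 < a₀) (ha₁ : a₀ ≤ a₁) :
    ∃ δ : ℝ, 0 < δ ∧ ∃ C : ℝ, 0 ≤ C ∧ ∀ (m K : ℕ) (j : ℕ) (hc : ((L : ℝ) ^ j) ≠ 0)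
      (hj : j + 1 ≤ (⟨d + 1, L, m, K, hd, hL⟩ : Params).m + (⟨d + 1, L, m, K, hd, hL⟩ : Params).K)
      (Λ' : Finset (Site (⟨d + 1, L, m, K, hd, hL⟩ : Params) (j + 1))) (a : ℝ) (ha : 0 < a)
      (_hw0 : ∀ i, a₀ * ((L : ℝ) ^ j) ^ (d + 1) ≤ wPrinted (⟨d + 1, L, m, K, hd, hL⟩ : Params) j Λ' a i)
      (_hw1 : ∀ i, wPrinted (⟨d + 1, L, m, K, hd, hL⟩ : Params) j Λ' a i ≤ a₁ * ((L : ℝ) ^ j) ^ (d + 1))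
      (r : ℝ) (_hr : 0 ≤ r) (B : BondIdxSpace (twoScale j hj Λ')) (X : ℝ) (_hX : 0 ≤ X) (y y' : Site (⟨d + 1, L, m, K, hd, hL⟩ : Params) j)
      (_hsupp : ∀ p : BondIdx (twoScale j hj Λ'), B p ≠ 0 →
        torusSupNorm (Mk (⟨d + 1, L, m, K, hd, hL⟩ : Params) j) (rep (Mk (⟨d + 1, L, m, K, hd, hL⟩ : Params) j) ((Sum.elim (fun o : OutBond j Λ' => o.1.src)
              (fun b₁ : InBond j Λ' => Site.blockSite b₁.1.src (fun _ => ⟨0, Params.L_pos _⟩)) :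
                CIdx j Λ' → Site (⟨d + 1, L, m, K, hd, hL⟩ : Params) j) ((Equiv.ofBijective (toBondIdx hj Λ') (toBondIdx_bijective hj Λ')).symm p)) - rep (Mk (⟨d + 1, L, m, K, hd, hL⟩ : Params) j) y') ≤ r)
      (_hB : ∀ p : BondIdx (twoScale j hj Λ'), |B p| ≤ X)
      (b₀ : PBond (⟨d + 1, L, m, K, hd, hL⟩ : Params) 0) (_hb₀ : torusSupNorm (Mk (⟨d + 1, L, m, K, hd, hL⟩ : Params) j) (rep (Mk (⟨d + 1, L, m, K, hd, hL⟩ : Params) j) (iterBlockOf j b₀.src) - rep (Mk (⟨d + 1, L, m, K, hd, hL⟩ : Params) j) y) ≤ r),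
      |hOp (GE (twoScale j hj Λ') hc (w := wLevel (⟨d + 1, L, m, K, hd, hL⟩ : Params) j a) (wLevel_pos (j := j) ha))
          (QsE (twoScale j hj Λ')) (EE (twoScale j hj Λ') hc (w := wLevel (⟨d + 1, L, m, K, hd, hL⟩ : Params) j a) (wLevel_pos (j := j) ha)) B b₀| ≤
        C * Real.exp ((1 + 2 * δ) * r) * Real.exp (-(δ * torusSupNorm (Mk (⟨d + 1, L, m, K, hd, hL⟩ : Params) j) (rep (Mk (⟨d + 1, L, m, K, hd, hL⟩ : Params) j) y - rep (Mk (⟨d + 1, L, m, K, hd, hL⟩ : Params) j) y'))) * X := by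
  obtain ⟨δ, hδ, C, hC, h⟩ := cor28_ineq2151_H d L hd hL ha₀ ha₁
  refine ⟨δ, hδ, C, hC, fun m K j hc hj Λ' a ha hw0 hw1 r hr B X hX y y' hsupp hB b₀ hb₀ => ?_⟩
  set e := Equiv.ofBijective (toBondIdx hj Λ') (toBondIdx_bijective hj Λ') with he
  have hHB : hOp (GE (twoScale j hj Λ') hc (w := wLevel (⟨d + 1, L, m, K, hd, hL⟩ : Params) j a) (wLevel_pos (j := j) ha))
      (QsE (twoScale j hj Λ')) (EE (twoScale j hj Λ') hc (w := wLevel (⟨d + 1, L, m, K, hd, hL⟩ : Params) j a) (wLevel_pos (j := j) ha)) B =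
      Hts hc Λ' (w := wPrinted (⟨d + 1, L, m, K, hd, hL⟩ : Params) j Λ' a) ((reindex hj Λ').symm B) := by
    rw [hOp_eq hc hj Λ' ha, LinearMap.comp_apply]
    rfl
  rw [hHB]
  refine h m K j hc hj Λ' (wPrinted (⟨d + 1, L, m, K, hd, hL⟩ : Params) j Λ' a) hw0 hw1 r hr ((reindex hj Λ').symm B) X hX y y'
    (fun i hi => ?_) (fun i => ?_) b₀ hb₀
  · rw [reindex_symm_apply] at hi
    have := hsupp (toBondIdx hj Λ' i) hi
    rwa [show e.symm (toBondIdx hj Λ' i) = i from e.symm_apply_apply i] at this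
  · rw [reindex_symm_apply]
    exact hB _

end Uniform

end Literature.MathematicalPhysics.QuantumFieldTheory.Balaban1983to89.B6Cor28TwoScaleV1

end
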